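import Summits.AtomisticToContinuum.HydrodynamicLimit.Theses.JParityClosure
import Literature.Analysis.FluidPDE.ConfinedHardSphereFlowShortBad
import Literature.Analysis.FluidPDE.SphereMeasureSymmetry
import Literature.MathematicalPhysics.KineticTheory.TaggedSphereCollisionFrequency

/-!
# Disproof of `EvenStressEnskog` — standing adversary's work file

Crux `stmt-AtomisticToContinuum-13079` = `Summit.AtomisticToContinuum.HydrodynamicLimit.Theses.
JParityClosure.EvenStressEnskog` (route JParityClosure, rank 3, configurational half): the J-even
collisional momentum-transfer marks `Ξ_P^{kl}(n̂,v,w) = ((w−v)·n̂)₊ n̂_k n̂_l`, summed over the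
collisions of the TRUE `(N+1)`-sphere dynamics with weight `χ(s,x_i) g(σ³ρ_r(x_i))`, equal in
probability (local Gibbs law; `N → ∞` at fixed `r`, then `r → 0`) the Enskog functional
`σ³ ∫₀^τ∫ χ g(σ³ρ_r) Y(σ³ρ_r) B_r`, with the THERMODYNAMIC contact value
`Y = (3/2π)·deriv hsExcessFreeEnergy`.

## Findings — cycle 1 (2026-08-16, refuter-cdisprove-stmt-AtomisticToContinuum-13079-0)

**No kill. The crux resists every cheap attack; it is "propagation of local equilibrium in the
J-even momentum channel" and any Lean refutation needs a LOWER bound, in local-Gibbs probability,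
on a collision functional of the deterministic hard-sphere flow for arbitrarily large `N` — no such
bound exists in the tree or in print (§6).** What this file proves (all `sorry`-free):

* §1 the `let`-bound objects of the crux as named definitions, and `evenStressEnskog_iff`
  (restatement by `Iff.rfl`) — so every lemma below applies to the crux verbatim;
* §2 mark algebra: `Ξ_P` is J-even (`xiP_J_even`, for EVERY impact vector, unit or not), symmetric
  under the ordered-pair swap `(n,v,w) ↦ (−n,w,v)` (`xiP_swap`: both ordered pairs of one collision
  contribute the same value), vanishes off the incoming hemisphere (`xiP_eq_zero_of_not_incoming`)
  and is evaluated ON its support at every genuine collision (`inner_pos_of_isIncoming`: the tree's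
  `IsIncoming` is exactly `0 < ⟪w − v, n̂⟫` in the mark's variables); its trace is the bare rate
  mark `((w−v)·n̂)₊‖n̂‖²` (`xiP_trace`) — so **the trace of the crux is the Enskog collision-
  frequency law** `K_N[χ g ((w−v)·n̂)₊] → σ³∫∫χ g Y B^{rate}`: any collision-frequency anomaly of
  the true dynamics at the Euler scale kills the crux (none is known, §6);
* §3 JUNK AUDIT, proved: `deriv hsExcessFreeEnergy 0 = 0`, hence the crux's contact value
  satisfies `Y 0 = 0` although the physical contact value is `Y(0⁺) = 1`. Mechanism: `Real.rpow`
  of a negative base makes `hsFreeVolume η N = hsFreeVolume (−η/8) N` for `η < 0`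
  (`(x)^{1/3} = |x|^{1/3} cos(π/3)`), so `f_ex(η) = f_ex(−η/8)` on `η ≤ 0` and a two-sided
  derivative at `0`, if it exists, equals `−1/8` of itself;
* §4 the junk is HARMLESS in the crux: `B_r(x₀) = 0` wherever `ρ_r(x₀) = 0`
  (`Bfun_eq_zero_of_rhoM_eq_zero`), so `Y(σ³ρ_r)·B_r` never sees `Y 0`; and the LIMIT ORDER is
  load-bearing: on the hard-sphere domain `B_r ≡ 0` as soon as `2r < ε`
  (`Bfun_eq_zero_of_two_r_lt` — two distinct spheres never share a cone), so the variant of the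
  crux with `r = r_N < ε_N/2` is the (physically false) claim `K_N[χ g Ξ_P] → 0`;
* §5 two natural auxiliary claims a prover might write are FALSE as Lean statements:
  `¬ ∀ a ∈ Ico 0 η₀, 1 ≤ Y a` (the "Enskog floor Y ≥ 1" of RateFloor's docstring, stated with the
  closed left end) and `Tendsto Y (𝓝[>] 0) (𝓝 1) → ¬ ContinuousWithinAt Y (Ici 0) 0` (Y is not
  right-continuous at `0`; HsEosLowDensity's analytic `F` has `F′(0) = 2π/3 ≠ deriv f_ex 0`).
  Provers: state every regularity / positivity property of `Y` on the OPEN band `Ioo 0 η₀`, via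
  the `F` of `HsEosLowDensity` (stmt-0768), never via `deriv hsExcessFreeEnergy` at `0`.

§6 (docstring `resists`) records why no counterexample is reachable and what WOULD kill it;
§7 the attack log; §8 PROVES the reduction `EvenStressEnskog → EnskogFrequencyLawSplit` (the crux
implies the Enskog collision-frequency law for the bare rate mark; contrapositive = formal kill
target 4(a): any Euler-scale collision-frequency anomaly refutes the crux).

LANDED under `Theorems/EvenStressEnskog/Negative/` (importable by ideators / planners / provers):
* `ContactValueZero.lean` — p72657 ACCEPTED (commit 478f5526dbf6): `EvenStressEnskog.
  deriv_hsExcessFreeEnergy_zero`, `contactValue_zero`, `not_one_le_contactValue_on_Ico`,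
  `not_continuousWithinAt_contactValue`, `hsFreeVolume_of_neg`, `hsExcessFreeEnergy_of_nonpos`;
* `PairFunctionalVanishing.lean` — p72921 ACCEPTED: `pairFunctional_eq_zero_of_two_r_lt`,
  `pairFunctional_flow_eq_zero_of_two_r_lt`, `pairFunctional_eq_zero_of_mollifiedDensity_eq_zero`,
  `integral_prod_empirical_eq_zero`, `ae_prod_empirical_mem_range` (all on the verbatim let-bodies);
* `FrequencyLawReduction.lean` — p73612 ACCEPTED (commit d908e7797986): `frequencyLawSplit_of_
  evenStressEnskog` (§8), `collisionFunctional_sum`, `measure_rate_le`, `rateMark_eq_sum_diag`,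
  `localGibbsLaw_compl_good`;
* `SwappedOrderTrivial.lean` — p74513 ACCEPTED (cycle 2, commit 9393013dfa8e):
  `evenStressEnskog_swappedOrder` (§9: the crux with the two limits swapped is PROVED, junk-true),
  `self_le_mollifiedDensity`, `cutoff_self_eq_zero`, `collisionFunctional_eq_zero_of_forall`,
  `deviation_eq_zero_of_small_r`;
* `EnskogSideMoments.lean` — p75943 ACCEPTED (cycle 2, commit d1d5a2c5954c): `sphereMarkP_eq_half`,
  `sphereMarkP_galilei/symm/smul`, `empiricalMeasure_prod_eq`, `integral_prod_empiricalMeasure`,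
  `sum_sum_mul_mul_sq_sub`, `pairFunctionalP_eq_moment` (§10–§11 on the verbatim let-bodies).
* `TwoStreamTexture.lean` — p83550 (cycle 2, submitted; dry-run ACCEPT): `sphereMarkP_trace_eq`,
  `integral_sq_pos_of_integral_pos`, `sphereMarkP_trace_pos`, `pairFunctionalP_two_stream` (§12).
Cited from the predecessor one-shot attack (evidence CruxAttack_stmt13079.md,
refuter-rattack-…-13079-0): sign-convention audit and the `Y 0` observation — both re-derived
here, the latter now a theorem.

## Findings — cycle 2 (2026-08-16, refuter-cdisprove-stmt-AtomisticToContinuum-13079-g2-0)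

**Still no kill** (the §6 obstruction stands: `¬S` needs an in-probability LOWER bound on a
collision functional of `N+1 → ∞` deterministic spheres at fixed `σ`; nothing in the tree or in
print supplies one). New, all `sorry`-free:

* §9 **the SWAPPED limit order is junk-TRUE** (`evenStressEnskogSwapped_holds`, landed verbatim as
  `Negative/SwappedOrderTrivial.lean`): with `∃ N₀ ∀ N ≥ N₀ ∃ r₀ ∀ r < r₀` both sides of the crux
  vanish identically on good orbits — the cutoff read at a particle sees the particle's OWN cone
  mass `3/(πr³(N+1))` ("self-smearing", `self_le_rhoM`), which exceeds `η₀/σ³` as `r → 0` at fixed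
  `N`, so `K_N[χ g Ξ] = 0` for every mark; and `B_r ≡ 0` once `2r < ε_N` (§4). Complements §4: the
  ORDER of the limits carries all the content; `r` may never depend on `N` (not even `r_N = ε_N/2`,
  `succ_mul_half_hsDiameter_pow_three`), and in the honest order the prover must absorb the
  self-term `3σ³/(πr³(N+1)) → 0` inside `g`'s argument before `r → 0`;
* §10 **second-moment blindness of the Enskog side** (`Theta_XiP_eq_half`): by antipodal symmetry
  `Θ(Ξ_P^{kl})(v,w) = ½∫((w−v)·ω)² ω_kω_l dω` is an honest QUADRATIC FORM of `w − v` — Galilei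
  invariant (`Theta_XiP_galilei`), swap-symmetric (`Theta_XiP_symm`), degree-2 homogeneous
  (`Theta_XiP_smul`), symmetric in `(k,l)` (`Theta_XiP_comm`); with `integral_prod_empiricalMeasure`
  / `Bfun_eq_sum` (`∫ F d(μ_z⊗μ_z) = (N+1)⁻² ΣΣ F(z_i,z_j)`) the Enskog functional `B_r(Ξ_P^{kl})`
  reads the local velocity law ONLY through `ρ_r, m_r` and second moments. Consequences for the
  attack: (i) no counterexample can come from a non-Maxwellian ONE-body law with Maxwellian second
  moments — only the pair CORRELATION at contact can break the crux; (ii) CORRECTION of a loose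
  word of cycle 1: the trace mark `XiRate` (§8) measures the IMPULSE sum `Σ_coll 2|g·n̂|`, i.e. the
  collisional virial / pressure, NOT the bare collision count (mark `1`, `Θ(1) = π|w−v|`, which the
  crux does NOT control). Kill target 4(a) must read "an Euler-scale anomaly of the impulse rate
  (collisional pressure)"; an anomalous collision COUNT with correct impulse sum would not refute
  the crux. The names `EnskogFrequencyLawSplit` / `FrequencyLawReduction` are kept for continuity.
* §12 **hidden content — mesoscale compactness** (`Bfun_two_stream`, `Theta_trace_pos`, landed
  verbatim as `Negative/TwoStreamTexture.lean`): on a two-stream velocity texture (families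
  `u₁ ≠ u₂` interleaved at scale `ℓ`, `ε_N ≪ ℓ ≪ r`, mutually segregated) the collision side is
  `0` along free flight while the Enskog side is `2σ³(N+1)⁻²W₁W₂·Y·Θ(u₁,u₂) > 0` for EVERY `r` —
  the crux fails surely there although KINETIC local equilibrium (crux #2, contact value `Y`)
  can hold exactly: `EvenStressEnskog` tacitly asserts strong (not Young-measure) compactness of
  the empirical velocity field between `λ_N` and `o(1)` scales. §6.3 is amended accordingly;
  pre-shock no texture can form from smooth profiles in `N`-independent time, post-singularity
  it is unknown (K41 says no defect); RECOMMENDATION: `τ < T`. The lead's S3 inherits this.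
* §11 **moment form** (`Bfun_XiP_eq_moment`, landed verbatim as `pairFunctionalP_eq_moment`):
  `B_r(Ξ_P^{kl})(x₀) = (N+1)⁻² ∫ [S₀S₂(ω) − S₁(ω)²] ω_kω_l dω` with the mollified moments
  `S₀ = Σb`, `S₁(ω) = Σb⟪v,ω⟫`, `S₂(ω) = Σb⟪v,ω⟫²` — a directional velocity VARIANCE; at a local
  Maxwellian `(ρ,u,θ)` and `r → 0` the crux's prediction is the isotropic collisional pressure
  `σ³Y(σ³ρ)(4π/3)ρ²θ δ_kl` and ZERO collisional shear stress.
* §7 (log): `kit compute` EDMD toy (pure-python event-driven MD written for this crux; smoke test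
  j010361 exit 0: no overlaps, energy conserved to 1e-16): `K_N[Ξ_P^{kl}]` of the true dynamics
  vs the crux's Enskog functional in its exact moment form (§11) for EXACT local-Gibbs data
  (uniform activity ⇒ equilibrium configuration × local Maxwellian: equilibrium / shear wave /
  temperature wave), `σ³ = 0.2`, `τ = 0.4`; production runs j010547 (`r = 0.1`,
  `N+1 ∈ {512,1728,4096,8000}`, 3 reps) and j013847 (`r = 0.2`, `N+1 ∈ {1728,4096,8000}`) queued
  (cluster wait hours). RESULTS of j010547 (`r = 0.1`, 36 runs, 703 s; energy conserved to
  1e-16, no overlaps; evidence compute-j010547.json on the item), `rel := (trK − trE)/trE`,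
  mean ± stderr over 3 replicas:
      N+1 :      512          1728          4096          8000     (Kn ≈ .062 .042 .031 .025)
      eq   : +.134±.004    +.055±.005    +.024±.005    +.008±.003
      shear: +.123±.015    +.050±.010    +.022±.004    +.012±.003
      temp : +.128±.007    +.055±.008    +.026±.002    +.013±.001
  (i) COLLISION SIDE = ENSKOG/CS TO 0.5%: in equilibrium `trK/(4πσ³Y_CS(σ³)θ_kin τ)` = 0.9996(42),
  1.0053(51), 1.0021(42), 0.9966(28) at the four sizes — an independent confirmation of the
  crux's normalisation (`ε/(N+1)`, ordered pairs, `|S²|`, `Y = χ_c`) at the percent level;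
  (ii) the whole deviation sits on the `r`-MOLLIFIED ENSKOG ESTIMATOR: `trE/theory` = 0.882,
  0.953, 0.979, 0.988, i.e. `rel ≈ 0.08/((N+1)r³)` (`(N+1)r³` = 0.5, 1.7, 4.1, 8) — the numerical
  echo of §4/§9: the functional `Y(σ³ρ_r)B_r` is an honest object only for `N r³ ≫ 1`, `N → ∞`
  BEFORE `r → 0` (smoke test at `N+1 ≤ 125`: spiky `σ³ρ_r ≤ 2.5`, `trE` low by a factor 2);
  (iii) NO NON-EQUILIBRIUM ANOMALY at the 0.5–1.5% level: `rel(shear) − rel(eq)` = −.011±.015,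
  −.005±.012, −.002±.006, +.004±.004 and `rel(temp) − rel(eq)` = −.006±.008, .000±.009,
  +.003±.005, +.005±.003 (Mach-0.6 shear wave, ±70% temperature wave, one Euler time, 10–26
  collisions per particle); (iv) the collisional shear stress is `O(Kn)` and dies: shear-run
  `K^{01}` = −.0104±.0044, −.0007±.0009, −.0002±.0018, −.0008±.0005 against `trK/3 ≈ 0.46`,
  with `E^{01} ≈ 0`; normal-stress anisotropy `(K^{11}−K^{22})−(E^{11}−E^{22})` ≤ .011 (N+1=512)
  → ≤ .004. Companion j013847 (`r = 0.2`, prediction: estimator bias 8× smaller) pending.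
  VERDICT of the toy: everything measurable is consistent with the crux and with an `O(Kn)` +
  `O(1/(N r³))` approach; it cannot refute, and it does not hint at a refutation.
* §7 (log) physics re-audit of the normalisation from first principles (ordered-pair flux through
  the contact sphere, `Y = (3/2π)f_ex′` via `Z = 1 + (2π/3)ηχ_c`): consistent, fourth independent
  confirmation; the crux is correct to ALL orders in `η` below `η₀` at Euler order in `Kn` (ring /
  repeated-collision corrections to the contact value are `O(Kn·ηᵏ)`); shocks, contact
  discontinuities, implosion-type density blow-up (cut off by `g`), post-shock times: all absorbed
  by measure-zero sets in the `N → ∞` then `r → 0` order. Literature sweep: searchd rc 75 again at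
  session start (retried later in the session, see §7).
-/

noncomputable section

namespace Summit.AtomisticToContinuum.HydrodynamicLimit.Cruxes.EvenStressEnskog.Disproof

open scoped InnerProductSpace Topology ENNReal
open MeasureTheory Filter Set
open Literature.MathematicalPhysics.KineticTheory Literature.Analysis.FluidPDE
open Summit.AtomisticToContinuum.HydrodynamicLimit.Theses.JParityClosure

/-! ## §1 The objects of the crux, named -/

/-- Velocity space `ℝ³`. -/
abbrev E3 : Type := EuclideanSpace ℝ (Fin 3)

/-- The torus geometry of the crux. -/
abbrev G3 : Geometry (Fin 3) T3 := Torus.geometry (Fin 3)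

/-- The J-even collisional momentum-transfer mark `Ξ_P^{kl}(n,v,w) = ((w−v)·n)₊ n_k n_l`
(verbatim the crux's `ΞP`). -/
def XiP (k l : Fin 3) (q : E3 × E3 × E3) : ℝ :=
  max ⟪q.2.2 - q.2.1, q.1⟫_ℝ 0 * (q.1 k * q.1 l)

/-- The thermodynamic contact value `Y(a) = (3/2π)·f_ex′(a)` (verbatim the crux's `Y`;
`deriv` junk `0` where `hsExcessFreeEnergy` is not differentiable — in particular AT `a = 0`,
§3). -/
def Y (a : ℝ) : ℝ := 3 / (2 * Real.pi) * deriv hsExcessFreeEnergy a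

/-- The normalised cone mollifier `b_r(x,y) = 3/(πr³)·(1 − dist(x,y)/r)₊` (verbatim `bx`). -/
def bx (r : ℝ) (x y : T3) : ℝ :=
  3 / (Real.pi * r ^ 3) * max (1 - Torus.euclidDist x y / r) 0

/-- The sphere-integrated mark `Θ Ξ v w = ∫ Ξ(ω,v,w)((w−v)·ω)₊ dω` (verbatim `Θ`). -/
def Theta (Ξ : E3 × E3 × E3 → ℝ) (v w : E3) : ℝ :=
  ∫ ω : Metric.sphere (0 : E3) 1, Ξ ((ω : E3), v, w) * hardSphereKernel (w, v) ω ∂sphereMeasure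

/-- The `r`-mollified empirical density `ρ_r(x₀) = ∫ b_r(x,x₀) dμ_z` (verbatim `ρm` at a fixed
configuration). -/
def rhoM {N : ℕ} (r : ℝ) (z : Config N (Fin 3) T3) (x₀ : T3) : ℝ :=
  ∫ q, bx r q.1 x₀ ∂(empiricalMeasure z)

/-- The `r`-mollified pair functional `B_r Ξ (x₀) = ∫∫ b_r b_r Θ dμ_z dμ_z` (verbatim `B` at a
fixed configuration; the diagonal `i = j` is included and contributes `0`, `Theta_self`). -/
def Bfun {N : ℕ} (r : ℝ) (Ξ : E3 × E3 × E3 → ℝ) (z : Config N (Fin 3) T3) (x₀ : T3) : ℝ :=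
  ∫ p, bx r p.1.1 x₀ * bx r p.2.1 x₀ * Theta Ξ p.1.2 p.2.2
    ∂((empiricalMeasure z).prod (empiricalMeasure z))

/-- Pre-collisional velocities recovered from the (right-continuous, post-collisional)
configuration by the involution `reflectVel` (verbatim `pv`). -/
def pv {N : ℕ} (z : Config N (Fin 3) T3) (i j : Fin N) : E3 × E3 :=
  reflectVel (G3.sepVec (z i).1 (z j).1) ((z i).2, (z j).2)

/-- The normalised collision functional `K_N[Fn] = ε/(N+1) Σ_{collision times ≤ τ} Σ_{ordered
contact pairs} Fn` along a family of paths `γ z` (verbatim `Kc`). -/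
def Kc {N : ℕ} (ε τ : ℝ) (γ : Config (N + 1) (Fin 3) T3 → ℝ → Config (N + 1) (Fin 3) T3)
    (Fn : Config (N + 1) (Fin 3) T3 → ℝ → Fin (N + 1) → Fin (N + 1) → ℝ)
    (z : Config (N + 1) (Fin 3) T3) : ℝ :=
  ε / (N + 1 : ℝ) * ∑ᶠ (s : ℝ) (_ : s ∈ collisionTimes G3 ε (γ z) ∩ Set.Icc 0 τ),
    ∑ i : Fin (N + 1), ∑ j : Fin (N + 1),
      (if i ≠ j ∧ ‖G3.sepVec (γ z s i).1 (γ z s j).1‖ = ε then Fn z s i j else 0)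

/-- The crux restated with the named pieces (same quantifier prefix, same body). -/
def EvenStressEnskogNamed : Prop :=
  ∃ η₀ : ℝ, 0 < η₀ ∧ ∀ (a₀ θ₀ : T3 → ℝ) (u₀ : T3 → V3), Continuous a₀ → Continuous θ₀ →
    Continuous u₀ → (∀ x, 0 < a₀ x) → (∀ x, 0 < θ₀ x) → ∃ σ₀ : ℝ, 0 < σ₀ ∧ ∀ σ : ℝ, 0 < σ →
    σ < σ₀ → ∀ Φ : (N : ℕ) → HardSphereFlow G3 (hsDiameter σ N) (N + 1), ∀ τ : ℝ, 0 < τ →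
    ∀ χ : ℝ × T3 → ℝ, Continuous χ → ∀ g : ℝ → ℝ, Continuous g → (∀ a, η₀ ≤ a → g a = 0) →
    ∀ η δ : ℝ, 0 < η → 0 < δ → ∃ r₀ : ℝ, 0 < r₀ ∧ ∀ r : ℝ, 0 < r → r < r₀ → ∃ N₀ : ℕ,
    ∀ N : ℕ, N₀ ≤ N →
      let ε := hsDiameter σ N
      let γ := fun z (s : ℝ) => (Φ N).flow s z
      let Dm := fun (Ξ : E3 × E3 × E3 → ℝ) z =>
        Kc ε τ γ (fun z s i j => χ (s, (γ z s i).1) * g (σ ^ 3 * rhoM r (γ z s) (γ z s i).1) *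
          Ξ (ε⁻¹ • G3.sepVec (γ z s i).1 (γ z s j).1, (pv (γ z s) i j).1, (pv (γ z s) i j).2)) z -
        σ ^ 3 * ∫ s in Set.Icc (0 : ℝ) τ, ∫ x : T3,
          χ (s, x) * g (σ ^ 3 * rhoM r (γ z s) x) * Y (σ ^ 3 * rhoM r (γ z s) x) *
            Bfun r Ξ (γ z s) x
      ∀ k l : Fin 3, localGibbsLaw σ a₀ u₀ θ₀ N (Φ N) {z | η < |Dm (XiP k l) z|} ≤ ENNReal.ofReal δ

/-- The crux IS the named statement (definitional unfolding; `Iff.rfl`). Every lemma of this file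
about `XiP`, `Y`, `bx`, `Theta`, `rhoM`, `Bfun`, `pv`, `Kc` therefore applies to the crux
verbatim. -/
theorem evenStressEnskog_iff : EvenStressEnskog ↔ EvenStressEnskogNamed := Iff.rfl

/-! ## §2 Mark algebra: parity, pair-swap symmetry, support, trace -/

/-- `Ξ_P` is J-even: `Ξ_P(−n, v′, w′) = Ξ_P(n, v, w)` with `(v′,w′) = reflectVel n (v,w)`, for
EVERY `n` (unit or not; `n = 0` is the identity junk case). Hence `OddContactSymmetry` (crux r2,
J-odd marks) is silent about this mark: the parity split of the route is genuine. -/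
theorem xiP_J_even (k l : Fin 3) (n v w : E3) :
    XiP k l (-n, (reflectVel n (v, w)).1, (reflectVel n (v, w)).2) = XiP k l (n, v, w) := by
  unfold XiP reflectVel
  simp only
  by_cases hn : n = 0
  · subst hn; simp
  · have hn2 : ‖n‖ ^ 2 ≠ 0 := pow_ne_zero 2 (norm_ne_zero_iff.mpr hn)
    have key : ⟪w + (⟪v - w, n⟫_ℝ / ‖n‖ ^ 2) • n - (v - (⟪v - w, n⟫_ℝ / ‖n‖ ^ 2) • n), -n⟫_ℝ
        = ⟪w - v, n⟫_ℝ := by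
      have h1 : w + (⟪v - w, n⟫_ℝ / ‖n‖ ^ 2) • n - (v - (⟪v - w, n⟫_ℝ / ‖n‖ ^ 2) • n)
          = (w - v) + (2 * (⟪v - w, n⟫_ℝ / ‖n‖ ^ 2)) • n := by
        rw [mul_smul, two_smul]; abel
      rw [h1, inner_neg_right, inner_add_left, inner_smul_left, real_inner_self_eq_norm_sq]
      simp only [conj_trivial]
      have : ⟪v - w, n⟫_ℝ = -⟪w - v, n⟫_ℝ := by rw [← inner_neg_left, neg_sub]
      rw [this]; field_simp; ring
    rw [key]
    simp

/-- Ordered-pair swap symmetry: the term of the ordered pair `(j,i)` (impact vector `−n`,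
velocities swapped) equals the term of `(i,j)`; each collision contributes `2·|g·n̂| n̂_k n̂_l`
to `K_N[Ξ_P^{kl}]` (up to the weights `χ, g∘ρ_r` read at `x_j` instead of `x_i`, an `O(ε/r)`
displacement). -/
theorem xiP_swap (k l : Fin 3) (n v w : E3) : XiP k l (-n, w, v) = XiP k l (n, v, w) := by
  unfold XiP
  simp only [inner_neg_right, PiLp.neg_apply, neg_mul_neg]
  congr 2
  rw [← inner_neg_left, neg_sub]

/-- The trace of the momentum-transfer mark is the bare collision-rate mark:
`Σ_k Ξ_P^{kk}(n,v,w) = ((w−v)·n)₊ ‖n‖²` (`= ((w−v)·n̂)₊` at a contact, `‖n̂‖ = 1`). So the trace of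
`EvenStressEnskog` (sum over `k = l`, same `χ, g`) is the ENSKOG COLLISION-FREQUENCY LAW with the
thermodynamic contact value — a two-sided rate statement, strictly stronger than `RateFloor`'s
one-sided `≥ g₀ ×` ideal rate on the same marks. -/
theorem xiP_trace (n v w : E3) :
    ∑ k, XiP k k (n, v, w) = max ⟪w - v, n⟫_ℝ 0 * ‖n‖ ^ 2 := by
  unfold XiP
  simp only
  rw [← Finset.mul_sum, EuclideanSpace.real_norm_sq_eq]
  congr 1
  refine Finset.sum_congr rfl fun k _ => ?_
  rw [sq]

/-- Diagonal marks are nonnegative. -/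
theorem xiP_diag_nonneg (k : Fin 3) (n v w : E3) : 0 ≤ XiP k k (n, v, w) := by
  unfold XiP
  exact mul_nonneg (le_max_right _ _) (mul_self_nonneg _)

/-- The mark vanishes unless the pair is incoming in the mark's variables (`0 < ⟪w − v, n⟫`). -/
theorem xiP_eq_zero_of_not_incoming (k l : Fin 3) (n v w : E3) (h : ⟪w - v, n⟫_ℝ ≤ 0) :
    XiP k l (n, v, w) = 0 := by
  unfold XiP
  simp [max_eq_right h]

/-- Convention check against the tree: `IsIncoming G z i j` (`⟪x_i − x_j, v_i − v_j⟫ < 0`, the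
property of the pre-collisional left limit in `IsHardSphereTrajectory.binary`) is exactly
`0 < ⟪v_j − v_i, sepVec x_i x_j⟫`, i.e. the mark's `((w−v)·n̂)₊` is evaluated on its support
with `n̂ = ε⁻¹(x_i − x_j)`, `v = v_i⁻`, `w = v_j⁻` — the crux is not trivially true by a sign
slip (a reversed hemisphere would have made `K_N[Ξ_P] ≡ 0`). -/
theorem inner_pos_of_isIncoming {N : ℕ} {d : Type*} [Fintype d] {X : Type*} (G : Geometry d X)
    (z : Config N d X) (i j : Fin N) (h : IsIncoming G z i j) :
    0 < ⟪(z j).2 - (z i).2, G.sepVec (z i).1 (z j).1⟫_ℝ := by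
  unfold IsIncoming at h
  have e : ⟪(z j).2 - (z i).2, G.sepVec (z i).1 (z j).1⟫_ℝ
      = -⟪G.sepVec (z i).1 (z j).1, (z i).2 - (z j).2⟫_ℝ := by
    rw [← inner_neg_right, neg_sub]
    exact real_inner_comm _ _
  rw [e]; linarith

/-- `pv` undoes the collision: `reflectVel n` is an involution for every `n` (so at a collision
time, where the configuration is post-collisional, `pv` returns the pre-collisional pair). -/
theorem reflectVel_reflectVel (n : E3) (p : E3 × E3) : reflectVel n (reflectVel n p) = p := by
  by_cases hn : n = 0
  · subst hn; simp
  · rw [reflectVel_eq_collide_unitDir n hn, reflectVel_eq_collide_unitDir n hn, collide_collide]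

/-! ## §3 Junk audit: the thermodynamic contact value is `0` at zero density -/

/-- `Real.rpow` of a negative base: `x^{1/3} = (−x/8)^{1/3}` for `x < 0`
(`x^y = exp(y log|x|) cos(πy)` and `cos(π/3) = 1/2 = 8^{-1/3}`). -/
theorem rpow_third_of_neg {x : ℝ} (hx : x < 0) :
    x ^ (1 / 3 : ℝ) = (-x / 8) ^ (1 / 3 : ℝ) := by
  have hx' : 0 < -x / 8 := by linarith
  rw [Real.rpow_def_of_neg hx, Real.rpow_def_of_pos hx']
  have h8 : Real.log 8 = 3 * Real.log 2 := by
    rw [show (8 : ℝ) = 2 ^ 3 by norm_num, Real.log_pow]; norm_num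
  have hlog : Real.log (-x / 8) = Real.log (-x) - Real.log 8 :=
    Real.log_div (by linarith) (by norm_num)
  rw [hlog, h8, Real.log_neg_eq_log, show (1 / 3 : ℝ) * Real.pi = Real.pi / 3 by ring,
    Real.cos_pi_div_three, sub_mul, Real.exp_sub]
  rw [show 3 * Real.log 2 * (1 / 3 : ℝ) = Real.log 2 by ring, Real.exp_log two_pos]
  ring

/-- The free volume at a NEGATIVE reduced density `η` is the free volume at `−η/8 > 0`
(the diameter `(η/N)^{1/3}` is a junk `rpow` of a negative base). -/
theorem hsFreeVolume_of_neg {η : ℝ} (hη : η < 0) (N : ℕ) :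
    hsFreeVolume η N = hsFreeVolume (-η / 8) N := by
  unfold hsFreeVolume
  rcases Nat.eq_zero_or_pos N with hN | hN
  · subst hN; simp
  · have hNr : (0 : ℝ) < N := by exact_mod_cast hN
    have h1 : η / N < 0 := div_neg_of_neg_of_pos hη hNr
    rw [rpow_third_of_neg h1, show -(η / (N : ℝ)) / 8 = (-η / 8) / N by ring]

/-- Hence the excess free energy is "even up to the factor 8": `f_ex(η) = f_ex(−η/8)` for
`η ≤ 0`. -/
theorem hsExcessFreeEnergy_of_nonpos {η : ℝ} (hη : η ≤ 0) :
    hsExcessFreeEnergy η = hsExcessFreeEnergy (-η / 8) := by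
  rcases hη.lt_or_eq with h | h
  · unfold hsExcessFreeEnergy
    simp_rw [hsFreeVolume_of_neg h]
  · subst h; simp

/-- **`deriv hsExcessFreeEnergy 0 = 0`**, unconditionally: either `f_ex` is not differentiable at
`0` (junk `0`), or its derivative `D` there is also the derivative of `η ↦ f_ex(−η/8)` within
`Iic 0`, i.e. `D = −D/8`, so `D = 0`. The physical right derivative is the second virial
coefficient `2π/3` (HsEosLowDensity, stmt-0768, states it for an analytic `F` that agrees with
`f_ex` on `Ico 0 η₀` only — correctly dodging this junk). -/
theorem deriv_hsExcessFreeEnergy_zero : deriv hsExcessFreeEnergy 0 = 0 := by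
  by_cases hd : DifferentiableAt ℝ hsExcessFreeEnergy 0
  · set D := deriv hsExcessFreeEnergy 0 with hD
    have h1 : HasDerivAt hsExcessFreeEnergy D 0 := hd.hasDerivAt
    have hφ : HasDerivAt (fun η : ℝ => -η / 8) (-1 / 8) 0 := by
      simpa using ((hasDerivAt_id (0 : ℝ)).neg.div_const 8)
    have h2 : HasDerivAt (hsExcessFreeEnergy ∘ fun η : ℝ => -η / 8) (D * (-1 / 8)) 0 := by
      have h1' : HasDerivAt hsExcessFreeEnergy D ((fun η : ℝ => -η / 8) 0) := by
        rw [show (fun η : ℝ => -η / 8) 0 = (0 : ℝ) by norm_num]; exact h1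
      exact h1'.comp (0 : ℝ) hφ
    have hU : UniqueDiffWithinAt ℝ (Set.Iic (0 : ℝ)) 0 := uniqueDiffOn_Iic 0 0 Set.self_mem_Iic
    have h3 : HasDerivWithinAt hsExcessFreeEnergy (D * (-1 / 8)) (Set.Iic 0) 0 :=
      h2.hasDerivWithinAt.congr (fun y hy => by
        simpa using hsExcessFreeEnergy_of_nonpos (Set.mem_Iic.mp hy)) (by simp)
    have h4 : HasDerivWithinAt hsExcessFreeEnergy D (Set.Iic 0) 0 := h1.hasDerivWithinAt
    have h5 : D = D * (-1 / 8) := (h4.derivWithin hU).symm.trans (h3.derivWithin hU)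
    linarith
  · exact deriv_zero_of_not_differentiableAt hd

/-- **The crux's contact value is `0` at zero density** (physically `Y(0⁺) = 1`). -/
theorem Y_zero : Y 0 = 0 := by simp [Y, deriv_hsExcessFreeEnergy_zero]

/-- Likewise `hsCompressibility 0 = 1` holds, but only because the junk derivative is
multiplied by `η = 0` there. -/
theorem hsCompressibility_zero : hsCompressibility 0 = 1 := by simp [hsCompressibility]

/-! ## §4 The pair functional: where the junk cannot bite, and why `N → ∞` before `r → 0` -/

/-- `Θ Ξ v v = 0`: the diagonal of `μ_z ⊗ μ_z` never contributes to `B_r`. -/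
theorem Theta_self (Ξ : E3 × E3 × E3 → ℝ) (v : E3) : Theta Ξ v v = 0 := by
  simp [Theta, hardSphereKernel]

/-- The cone mollifier is nonnegative. -/
theorem bx_nonneg {r : ℝ} (hr : 0 < r) (x y : T3) : 0 ≤ bx r x y := by
  unfold bx
  refine mul_nonneg ?_ (le_max_right _ _)
  positivity

/-- The cone mollifier is supported in the open ball of radius `r`. -/
theorem euclidDist_lt_of_bx_ne_zero {r : ℝ} (hr : 0 < r) {x y : T3} (h : bx r x y ≠ 0) :
    Torus.euclidDist x y < r := by
  by_contra hle
  push Not at hle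
  apply h
  unfold bx
  have : 1 - Torus.euclidDist x y / r ≤ 0 := by
    rw [sub_nonpos, le_div_iff₀ hr, one_mul]; exact hle
  rw [max_eq_right this, mul_zero]

/-- The empirical measure is carried by the particles. -/
theorem empiricalMeasure_compl_range {N : ℕ} (z : Config N (Fin 3) T3) :
    empiricalMeasure z (Set.range z)ᶜ = 0 := by
  have hS : MeasurableSet (Set.range z)ᶜ := (Set.finite_range z).measurableSet.compl
  rw [empiricalMeasure_eq, Measure.smul_apply, Measure.coe_finsetSum, Finset.sum_apply]
  have : ∀ i : Fin N, Measure.dirac (z i) (Set.range z)ᶜ = 0 := by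
    intro i
    rw [Measure.dirac_apply' _ hS, Set.indicator_of_notMem]
    simp
  simp [this]

/-- `μ_z ⊗ μ_z`-almost every pair of one-particle states is a pair of particles. -/
theorem ae_prod_empirical_mem_range {N : ℕ} (z : Config (N + 1) (Fin 3) T3) :
    ∀ᵐ p ∂((empiricalMeasure z).prod (empiricalMeasure z)),
      p.1 ∈ Set.range z ∧ p.2 ∈ Set.range z := by
  set μ := empiricalMeasure z with hμ
  have h0 : μ (Set.range z)ᶜ = 0 := empiricalMeasure_compl_range z
  have h1 : (μ.prod μ) ((Set.range z)ᶜ ×ˢ Set.univ) = 0 := by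
    rw [Measure.prod_prod, h0, zero_mul]
  have h2 : (μ.prod μ) (Set.univ ×ˢ (Set.range z)ᶜ) = 0 := by
    rw [Measure.prod_prod, h0, mul_zero]
  have h3 := measure_union_null h1 h2
  rw [ae_iff]
  refine measure_mono_null ?_ h3
  intro p hp
  simp only [Set.mem_setOf_eq, not_and_or] at hp
  rcases hp with hp | hp
  · exact Or.inl ⟨hp, Set.mem_univ _⟩
  · exact Or.inr ⟨Set.mem_univ _, hp⟩

/-- `B_r` vanishes as soon as its integrand vanishes on every ordered pair of particles. -/
theorem Bfun_eq_zero_of_vanish {N : ℕ} (r : ℝ) (Ξ : E3 × E3 × E3 → ℝ)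
    (z : Config (N + 1) (Fin 3) T3) (x₀ : T3)
    (h : ∀ i j, bx r (z i).1 x₀ * bx r (z j).1 x₀ * Theta Ξ (z i).2 (z j).2 = 0) :
    Bfun r Ξ z x₀ = 0 := by
  unfold Bfun
  refine integral_eq_zero_of_ae ?_
  filter_upwards [ae_prod_empirical_mem_range z] with p hp
  rcases hp with ⟨⟨i, hi⟩, ⟨j, hj⟩⟩
  rw [← hi, ← hj]
  simpa using h i j

/-- **Limit order is load-bearing.** On the hard-sphere domain of diameter `ε`, the Enskog pair
functional vanishes IDENTICALLY when `2r < ε`: two distinct spheres never lie in one cone of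
radius `r`, and the diagonal carries `Θ Ξ v v = 0`. So with `r = r_N < ε_N/2 = σ(N+1)^{-1/3}/2`
the subtracted term of the crux is `0` surely and the statement degenerates into
`K_N[χ g Ξ_P] → 0` in probability — false for the true dynamics (order `σ³`, §6), though not
refutable in Lean without a collision-count lower bound. Any prover's bookkeeping must keep
`r` fixed while `N → ∞` (as the crux does: `∃ r₀ ∀ r < r₀ ∃ N₀ ∀ N ≥ N₀`). -/
theorem Bfun_eq_zero_of_two_r_lt {N : ℕ} {r ε : ℝ} (hr : 0 < r) (h2r : 2 * r < ε)
    (Ξ : E3 × E3 × E3 → ℝ) (z : Config (N + 1) (Fin 3) T3)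
    (hz : z ∈ hardSphereDomain G3 (N + 1) ε) (x₀ : T3) :
    Bfun r Ξ z x₀ = 0 := by
  refine Bfun_eq_zero_of_vanish r Ξ z x₀ fun i j => ?_
  by_cases hij : i = j
  · subst hij; rw [Theta_self, mul_zero]
  by_cases hi : bx r (z i).1 x₀ = 0
  · rw [hi]; ring
  by_cases hj : bx r (z j).1 x₀ = 0
  · rw [hj]; ring
  exfalso
  have di := euclidDist_lt_of_bx_ne_zero hr hi
  have dj := euclidDist_lt_of_bx_ne_zero hr hj
  have hsep : ε ≤ Torus.euclidDist (z i).1 (z j).1 := by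
    have := (mem_hardSphereDomain.mp hz) i j hij
    rwa [Torus.norm_geometry_sepVec] at this
  have tri := Torus.euclidDist_triangle (z i).1 x₀ (z j).1
  rw [Torus.euclidDist_comm x₀] at tri
  linarith

/-- Along the flow the domain hypothesis holds: good orbits stay in the hard-sphere domain, so
`Bfun_eq_zero_of_two_r_lt` applies at every time to `(Φ N).flow s z`, `z ∈ (Φ N).good`. -/
theorem Bfun_flow_eq_zero_of_two_r_lt {N : ℕ} {r ε : ℝ} (hr : 0 < r) (h2r : 2 * r < ε)
    (Φ : HardSphereFlow G3 ε (N + 1)) {z : Config (N + 1) (Fin 3) T3} (hz : z ∈ Φ.good)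
    (s : ℝ) (Ξ : E3 × E3 × E3 → ℝ) (x₀ : T3) :
    Bfun r Ξ (Φ.flow s z) x₀ = 0 :=
  Bfun_eq_zero_of_two_r_lt hr h2r Ξ _ ((Φ.isTrajectory z hz).mem s) x₀

/-- **The `Y 0` junk is harmless in the crux.** Where the mollified density vanishes, every
particle is outside the cone, hence so is every pair: `B_r(x₀) = 0`, and the Enskog integrand
`χ g(σ³ρ_r) Y(σ³ρ_r) B_r` is `0` whatever `Y 0` is. (At particle positions `ρ_r ≥ 3/(πr³(N+1))
> 0`, so `g` and `Y` are only ever READ at arguments where `B_r` can be nonzero when `ρ_r > 0`.) -/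
theorem Bfun_eq_zero_of_rhoM_eq_zero {N : ℕ} {r : ℝ} (hr : 0 < r) (Ξ : E3 × E3 × E3 → ℝ)
    (z : Config (N + 1) (Fin 3) T3) (x₀ : T3) (h : rhoM r z x₀ = 0) : Bfun r Ξ z x₀ = 0 := by
  have hsum : ∑ i, bx r (z i).1 x₀ = 0 := by
    unfold rhoM at h
    rw [integral_empiricalMeasure] at h
    have hN : ((N + 1 : ℕ) : ℝ)⁻¹ ≠ 0 := by positivity
    exact (mul_eq_zero.mp h).resolve_left hN
  have hall : ∀ i, bx r (z i).1 x₀ = 0 := by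
    intro i
    exact (Finset.sum_eq_zero_iff_of_nonneg fun k _ => bx_nonneg hr (z k).1 x₀).mp hsum i
      (Finset.mem_univ i)
  refine Bfun_eq_zero_of_vanish r Ξ z x₀ fun i j => ?_
  rw [hall i]; ring

/-- The Enskog integrand of the crux at a point of zero mollified density is `0` (so the value
`Y 0 = 0` versus the physical `1` never enters). -/
theorem enskogIntegrand_eq_zero_of_rhoM_eq_zero {N : ℕ} {r : ℝ} (hr : 0 < r)
    (Ξ : E3 × E3 × E3 → ℝ) (z : Config (N + 1) (Fin 3) T3) (x₀ : T3) (c σ : ℝ) (g : ℝ → ℝ)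
    (h : rhoM r z x₀ = 0) :
    c * g (σ ^ 3 * rhoM r z x₀) * Y (σ ^ 3 * rhoM r z x₀) * Bfun r Ξ z x₀ = 0 := by
  rw [Bfun_eq_zero_of_rhoM_eq_zero hr Ξ z x₀ h, mul_zero]

/-! ## §5 Refuted auxiliary claims (natural strengthenings a prover might state) -/

/-- **False:** "the contact value is at least the ideal-gas value on the band `[0, η₀)`"
(RateFloor's docstring: "Enskog predicts γ ≥ Y ≥ 1"). With the crux's `Y` this fails AT `a = 0`
(`Y 0 = 0`). State such floors on `Ioo 0 η₀`, or for HsEosLowDensity's `F′`. -/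
theorem not_one_le_Y_on_Ico {η₀ : ℝ} (hη₀ : 0 < η₀) : ¬ ∀ a ∈ Set.Ico 0 η₀, 1 ≤ Y a := by
  intro h
  have := h 0 ⟨le_rfl, hη₀⟩
  rw [Y_zero] at this
  linarith

/-- **False:** "`Y` is continuous on the closed band" together with the physical limit
`Y(0⁺) = 1` (which follows from HsEosLowDensity: `F′(0) = 2π/3`). Precisely: if `Y a → 1` as
`a → 0⁺` then `Y` is NOT right-continuous at `0`. -/
theorem not_continuousWithinAt_Y (hlim : Tendsto Y (𝓝[>] 0) (𝓝 1)) :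
    ¬ ContinuousWithinAt Y (Set.Ici 0) 0 := by
  intro hc
  have h1 : Tendsto Y (𝓝[>] 0) (𝓝 (Y 0)) :=
    hc.tendsto.mono_left (nhdsWithin_mono _ Set.Ioi_subset_Ici_self)
  rw [Y_zero] at h1
  have := tendsto_nhds_unique h1 hlim
  norm_num at this

/-! ## §6 Why the crux resists (and what would kill it) -/

/-- **RESISTS (cycle 1).** Informal record, as a trivial theorem so that it is indexed.

1. *Faithfulness.* All sign / normalisation conventions check out formally (§2,
   `reflectVel_reflectVel`): trajectories are right-continuous, so `pv` gives PRE-collisional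
   velocities; `IsIncoming` ⇔ `0 < ⟪w−v, n̂⟫` ⇒ `Ξ_P` is read on its support for BOTH ordered
   pairs; `hardSphereKernel (w,v) ω = ((w−v)·ω)₊` is the same hemisphere as the mark, so
   `Θ^{kl}(v,w) = ∫((w−v)·ω)₊² ω_kω_l dω ≢ 0`; `|S²| = 4π`, ordered-pair factor `2`, cone
   normalisation `∫b_r = 1` (r < 1/2) and `μ_z` of mass `1` sit on both sides; expected value
   `E K_N[m] = σ³∫∫ρ²Y⟨m (g·n̂)₊⟩` matches `σ³∫∫Y B_r` (Enskog, Chapman–Cowling Ch. 16) and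
   `Y = (3/2π)f_ex′` is the virial/contact theorem (`Z = 1 + η f_ex′ = 1 + (2π/3)ηY`). The only
   junk (`Y 0 = 0`, §3) is multiplied by `B_r = 0` (§4). No vacuity: `HardSphereFlow` is
   inhabited (`HardSphereFlow.nonempty_torus_holds`), `localGibbsLaw ≪ liouville` with conull
   good set, so the truth value is `Φ`-independent (`flow_eq_ae`), and the local Gibbs law is a
   genuine probability measure for small `σ`.
2. *Shape of any refutation.* `¬EvenStressEnskog` = ∀ η₀ ∃ profiles ∀ σ₀ ∃ σ < σ₀ ∃ Φ τ χ g η δ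
   ∀ r₀ ∃ r < r₀ ∀ N₀ ∃ N ≥ N₀ ∃ k l, `P(η < |Dm|) > δ`. Whatever the witnesses, the last step is a
   LOWER bound on the local-Gibbs probability of an event defined through the collision history
   on `[0,τ]` of `N+1 → ∞` deterministic spheres at fixed reduced density. The tree has the flow
   (Alexander), exact identities along one path (collisional transfer / Bogolyubov identity,
   `EmpiricalEnskogIdentity`), static cluster expansions (first-order contact value) and flux
   formulas — but no in-probability control of ANY collision functional at positive times, and
   print has none either at fixed `σ` (Lanford-type control is Boltzmann–Grad and short-time).
   Exact identities do not help: the momentum balance pins only `Σ_l K_N[∂_l b · Ξ_P^{kl}]`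
   (with `g ≡ const`, which the ∃η₀-cutoff forbids us to arrange) against bounded transport terms
   — consistent with the crux (it IS the Euler momentum equation's collisional part).
3. *Physics.* At a local-equilibrium one-particle state the equal-time contact pair law of the
   Gibbs measure is exactly `Y(η)·M⊗M` on the incoming hemisphere (static fact; in GLOBAL
   equilibrium `E K_N` equals the flux of the invariant measure through the collision boundary,
   an exact billiard identity, and the `N → ∞` contact value is `Y` by HsEosLowDensity + virial
   theorem). Out of equilibrium the J-even contact corrections (ring / repeated-collision terms,
   shear-induced contact anisotropy: Lutsko 1996, 2001; van Beijeren–Ernst 1973) are responses to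
   gradients, `O(Kn) = O((N+1)^{-1/3})` at the Euler scaling, and vanish in the limit; the
   off-diagonal `k ≠ l` content of the crux is precisely "collisional shear stress / pressure
   → 0", i.e. collisional viscosity × Kn → 0. A counterexample therefore needs an `O(1)`-per-
   collision J-even contact anomaly at a Maxwellian one-particle state persisting over Euler
   times — equivalently an anomalous IMPULSE RATE (trace, `xiP_trace`; not the bare collision
   count, §10) or anisotropy;
   nothing of the kind is reported in hard-sphere MD (Alder–Wainwright, Erpenbeck–Wood collision
   rates = Enskog/CS to < 1 %; Lutsko's sheared-MD contact statistics are fitted by Enskog's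
   `Y` plus `O(shear rate)` terms). The honest status is: TRUE iff local equilibrium propagates in
   the two-body contact channel AND (cycle-2 amendment, §12) the empirical velocity field has no
   oscillation / two-stream texture at scales between `λ_N` and `o(1)` on a positive-measure
   part of `[0,τ] × 𝕋³` — the open core of the hydrodynamic limit plus its compactness half.
4. *What would kill it.* (a) A proof that the true IMPULSE rate (collisional virial,
   `Σ_coll 2|g·n̂|` per particle per unit time — cycle-2 correction of "collision frequency", §10)
   at the Euler scale differs from Enskog's `σ³Y·(4π/3)·(ρ_r trS_r − |m_r|²)` by `O(σ³)` in
   probability for some local-Gibbs profile (trace of the crux); (b) a stationary or long-lived non-equilibrium state of the deterministic gas with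
   Maxwellian one-body law but non-Enskog J-even contact law; (c) post-shock anomalies do NOT
   kill it as filed only if the non-equilibrium shock layers have vanishing space-time measure —
   the crux quantifies over ALL `τ > 0` (no Euler solution, no `τ < T`), so a profile developing
   a positive-measure set of non-equilibrium contact statistics after blow-up WOULD; no such
   phenomenon is known for hard spheres (shock width `O(Kn)`).
5. *Load-bearing hypotheses (informal; none is PROVABLY load-bearing for the same reason as 2).*
   `g = 0` on `[η₀,∞)` with `∃η₀` FIRST: load-bearing (dense pockets / freezing; also what blocks
   the exact-identity attack); `σ < σ₀(profiles)`: load-bearing (keeps `σ³ρ` in the band at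
   `t = 0`); `r < r₀` then `N ≥ N₀(r)`: load-bearing ORDER (§4); `Continuous χ, g`: convenience
   (a.e.-continuous bounded would do); `0 < τ`: decorative; `∀ τ` (post-shock) is stronger than
   the assembly needs (`τ < T` would suffice for ParityInBand) — a planner could weaken it at no
   cost if (4c) ever materialises. -/
theorem resists : True := trivial

/-! ## §7 Attack log (cycle 1) and next regimes

* elaboration: rc 0 (W.lean); `evenStressEnskog_iff` by `Iff.rfl` confirms the reading.
* degenerate instances: `N = 0` (one sphere: `K = 0`, `B = b²Θ(v,v) = 0`, `Dm = 0` — statement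
  true there, excluded anyway by `N ≥ N₀`); `2r < ε` (§4, excluded by the limit order);
  `ρ_r = 0` (§4, harmless); `n = 0` in `reflectVel`/`Ξ_P` (identity / zero, never met at a
  contact where `‖sepVec‖ = ε > 0`).
* junk audit: `Y 0 = 0` PROVED (§3); `hsFreeVolume`/`limsup`/`deriv` elsewhere only enter at
  `a ∈ (0, η₀)` where HsEosLowDensity makes them honest; Bochner junk (`∫ = 0` if
  non-integrable) in `∫_{[0,τ]}∫_x …` would turn the crux into the false-but-unrefutable
  `K_N → 0` — provers must SHOW integrability (piecewise-smooth in `s`, continuous in `x`).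
* strengthenings refuted: §5 (two). Strengthenings NOT refutable here: sure (every `z`)
  convergence; uniformity in `r`; dropping the cutoff.
* literature / negatives: barrier catalogue read this cycle — BoltzmannHypothesis (stationary-
  state classification: the only catalogued route to kill criterion 4(b); no non-Gibbs regular
  stationary state of 3-D hard spheres is known, and finite-N hard-ball systems are ergodic,
  Simányi), NoDensityExpansion (log-density terms live in TRANSPORT coefficients, i.e. at
  Navier–Stokes order `O(Kn)`, not in the Euler-order contact value — consistent with the crux),
  VelocityReversal(+Narrow) (forward laws in probability: not engaged). `lit search` degraded
  (searchd rc 75 ×2 this session) — the MD-literature sweep for collision-frequency anomalies is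
  carried to cycle 2 (route sources Lutsko1996/2001, vBE1973 already read by predecessors).
* Bochner-junk check of the Enskog term: the `x`-integrand is bounded Borel (`deriv` is
  measurable; `g = 0` above `η₀` kills any large-argument junk of `Y`; `Y 0 = 0`), the
  `s`-integrand piecewise continuous with finitely many pieces on good orbits — integrability is
  PROVABLE, so no hidden `∫ = 0` trap turns the crux into `K_N → 0`.
* reduction to the frequency law: DONE (§8, proved).
* NEXT (cycle 2): (i) a `kit compute` EDMD toy — non-equilibrium local-Gibbs shear/temperature
  wave at φ ≈ 0.05–0.2, per-collision `⟨(g·n̂)₊ n̂⊗n̂⟩` against `Y_CS(σ³ρ_r)·B_r`, scan in `N`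
  to exhibit the `O(Kn)` approach (quantifies the finite-`N` gap; cannot refute); (ii) try to
  make item 5's cutoff remark sharp: is `EvenStressEnskog` with `g ≡ 1` PROVABLY false via
  crystallisation? (no); (iii) targets from the lead's stuck stubs when a line is picked.

### Cycle 2 log (refuter-cdisprove-…-13079-g2-0)
* re-read: tree Disproof.lean, route decl, six crux idea cards + IdeatorOne/TwoSketch.lean (no
  line picked yet; `targets = []`); FrequencyLawReduction.lean found ACCEPTED (p73612).
* normalisation re-derived from first principles (ordered-pair incoming flux `n₂ ε²((w−v)·n̂)₊`,
  `E K_N = ε³N ∫Y f f Θ → σ³∫Y B_r`, `Y = χ_c` from `Z = 1 + (2π/3)ηχ_c = 1 + η f_ex′`): ✓.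
* swapped limit order: PROVED junk-true (§9) and landed verbatim (p74513).
* second-moment structure of the Enskog side: PROVED (§10); erratum "frequency → impulse".
* idea-card stubs read for cheap kills: `PairLiouville` (IdeatorTwo) — no integrability in `V`
  is assumed, but Bochner junk cannot produce a counterexample (with junk collision integrals the
  equation degenerates to free or damped transport along the lines `X + tV`, and two-sided decay
  at infinity forces `h = 0`); genuine non-`L²(M)` stationary pair modes not found cheaply — left
  to triage; `Rung0Identifies` / `CanonicalContactConvergence` — plausible given
  the crux, `deriv` junk only at isolated `N`; `UniversalEvenContactLaw` ⟺ crux given rung 0 —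
  same kill targets as §6.4(b). No stub is refutable by a small model.
* literature: searchd rc 75 at 01:3xZ; retried (see NOTES) — the MD sweep (Alder–Wainwright /
  Erpenbeck–Wood collision rates, Lutsko 1996/2001 sheared contact statistics) stands as recorded
  by predecessors; no printed Euler-scale impulse-rate anomaly for 3-D hard spheres below freezing.
-/

/-! ## §8 Reduction: the crux implies the Enskog impulse-rate ("frequency") law — kill target 4(a)

(Cycle-2 erratum, §10: `XiRate = ((w−v)·n)₊‖n‖²` is the IMPULSE mark — `K_N[XiRate]` is the sum of
the momentum transfers `2|g·n̂|`, the collisional virial — not the bare collision COUNT; "frequency"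
below is to be read as "impulse rate". The Lean names are kept.)
The trace of the crux (`xiP_trace`) is a statement about the collision impulse RATE. Formally: from
`EvenStressEnskog` (the three diagonal components `k = l`, tolerance `η/3`, confidence `δ/3`)
follows, by additivity of `K_N` in the mark on good orbits (finitely many collision times) and a
union bound off the Liouville-null bad set, the law below for the bare rate mark
`XiRate = ((w−v)·n)₊‖n‖² = Σ_k Ξ_P^{kk}`. The Enskog side is kept in SPLIT form `Σ_k I(Ξ_P^{kk})`
(equal to `I(XiRate) = σ³∫∫χ g Y B^{rate}` whenever the three Bochner integrals are honest —
stated this way so that NO integrability enters the reduction). Contrapositive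
(`not_evenStressEnskog_of_frequency_anomaly`): **any collision-frequency anomaly of the true
dynamics at the Euler scale, for one local-Gibbs profile at arbitrarily small `σ`, kills the crux.**
-/

/-- The bare collision-rate mark `((w−v)·n)₊ ‖n‖²`. -/
def XiRate (q : E3 × E3 × E3) : ℝ := max ⟪q.2.2 - q.2.1, q.1⟫_ℝ 0 * ‖q.1‖ ^ 2

/-- `XiRate = Σ_k Ξ_P^{kk}`. -/
theorem xiRate_eq_sum (q : E3 × E3 × E3) : XiRate q = ∑ k, XiP k k q := by
  obtain ⟨n, v, w⟩ := q
  rw [xiP_trace]; rfl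

/-- `K_N` is additive in the mark along any path with finitely many collision times in `[0,τ]`
(in particular along good orbits, `IsHardSphereTrajectory.locFinite`). Off such paths `∑ᶠ` is the
junk `0` and additivity may fail — hence the null-set bookkeeping in `measure_rate_le`. -/
theorem Kc_sum {N : ℕ} (ε τ : ℝ) (γ : Config (N + 1) (Fin 3) T3 → ℝ → Config (N + 1) (Fin 3) T3)
    (Fn : Fin 3 → Config (N + 1) (Fin 3) T3 → ℝ → Fin (N + 1) → Fin (N + 1) → ℝ)
    (z : Config (N + 1) (Fin 3) T3) (hfin : (collisionTimes G3 ε (γ z) ∩ Set.Icc 0 τ).Finite) :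
    Kc ε τ γ (fun z s i j => ∑ k, Fn k z s i j) z = ∑ k, Kc ε τ γ (Fn k) z := by
  unfold Kc
  simp_rw [finsum_mem_eq_finite_toFinset_sum _ hfin]
  rw [← Finset.mul_sum]
  congr 1
  set T := hfin.toFinset with hT
  set c : ℝ → Fin (N + 1) → Fin (N + 1) → Prop :=
    fun s i j => i ≠ j ∧ ‖G3.sepVec (γ z s i).1 (γ z s j).1‖ = ε with hc
  have hite : ∀ s (i j : Fin (N + 1)),
      (if c s i j then ∑ k, Fn k z s i j else 0) = ∑ k, (if c s i j then Fn k z s i j else 0) := by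
    intro s i j; split_ifs <;> simp
  calc ∑ s ∈ T, ∑ i, ∑ j, (if c s i j then ∑ k, Fn k z s i j else 0)
      = ∑ s ∈ T, ∑ i, ∑ j, ∑ k, (if c s i j then Fn k z s i j else 0) := by
        simp_rw [hite]
    _ = ∑ s ∈ T, ∑ i, ∑ k, ∑ j, (if c s i j then Fn k z s i j else 0) :=
        Finset.sum_congr rfl fun s _ => Finset.sum_congr rfl fun i _ => Finset.sum_comm
    _ = ∑ s ∈ T, ∑ k, ∑ i, ∑ j, (if c s i j then Fn k z s i j else 0) :=
        Finset.sum_congr rfl fun s _ => Finset.sum_comm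
    _ = ∑ k, ∑ s ∈ T, ∑ i, ∑ j, (if c s i j then Fn k z s i j else 0) := Finset.sum_comm

/-- Abstract probability step: if `Krate = Σ_k K_k` off a null set and each
`P(η/3 < |K_k − I_k|) ≤ δ/3`, then `P(η < |Krate − Σ_k I_k|) ≤ δ`. -/
theorem measure_rate_le {Ω : Type*} [MeasurableSpace Ω] (P : Measure Ω) (good : Set Ω)
    (hgood : P goodᶜ = 0) (K I : Fin 3 → Ω → ℝ) (Krate : Ω → ℝ)
    (hlin : ∀ z ∈ good, Krate z = ∑ k, K k z) {η δ : ℝ}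
    (hk : ∀ k, P {z | η / 3 < |K k z - I k z|} ≤ ENNReal.ofReal (δ / 3)) :
    P {z | η < |Krate z - ∑ k, I k z|} ≤ ENNReal.ofReal δ := by
  set A : Set Ω := {z | η < |Krate z - ∑ k, I k z|} with hA
  have hsub : A ∩ good ⊆ ⋃ k, {z | η / 3 < |K k z - I k z|} := by
    rintro z ⟨hzA, hzg⟩
    rw [Set.mem_iUnion]
    by_contra hno
    push Not at hno
    have hle : ∀ k, |K k z - I k z| ≤ η / 3 := fun k => by
      have := hno k; simp only [Set.mem_setOf_eq, not_lt] at this; exact this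
    have h1 : Krate z - ∑ k, I k z = ∑ k, (K k z - I k z) := by
      rw [hlin z hzg, Finset.sum_sub_distrib]
    have h2 : |Krate z - ∑ k, I k z| ≤ η := by
      rw [h1]
      calc |∑ k, (K k z - I k z)| ≤ ∑ k, |K k z - I k z| := Finset.abs_sum_le_sum_abs _ _
        _ ≤ ∑ _k : Fin 3, η / 3 := Finset.sum_le_sum fun k _ => hle k
        _ = η := by simp [Finset.sum_const]; ring
    have : η < |Krate z - ∑ k, I k z| := hzA
    linarith
  calc P A ≤ P (A ∩ good ∪ goodᶜ) := by
        refine measure_mono fun z hz => ?_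
        by_cases hzg : z ∈ good
        · exact Or.inl ⟨hz, hzg⟩
        · exact Or.inr hzg
    _ ≤ P (A ∩ good) + P goodᶜ := measure_union_le _ _
    _ = P (A ∩ good) := by rw [hgood, add_zero]
    _ ≤ P (⋃ k, {z | η / 3 < |K k z - I k z|}) := measure_mono hsub
    _ ≤ ∑ k, P {z | η / 3 < |K k z - I k z|} := measure_iUnion_fintype_le _ _
    _ ≤ ∑ _k : Fin 3, ENNReal.ofReal (δ / 3) := Finset.sum_le_sum fun k _ => hk k
    _ = ENNReal.ofReal δ := by
        rw [Finset.sum_const, Finset.card_fin, nsmul_eq_mul, Nat.cast_ofNat,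
          ← ENNReal.ofReal_ofNat 3, ← ENNReal.ofReal_mul (by norm_num)]
        congr 1; ring

/-- The bad set of the flow is invisible to the local Gibbs law (`≪ liouville`). -/
theorem localGibbsLaw_compl_good {σ : ℝ} {a₀ θ₀ : T3 → ℝ} {u₀ : T3 → V3} {N : ℕ}
    (Φ : HardSphereFlow G3 (hsDiameter σ N) (N + 1)) :
    localGibbsLaw σ a₀ u₀ θ₀ N Φ Φ.goodᶜ = 0 := by
  unfold localGibbsLaw particleLaw
  exact withDensity_absolutelyContinuous _ _ Φ.measure_compl_good

/-- **The Enskog collision-frequency law (split form)**: same quantifier prefix as the crux; the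
rate functional `K_N[χ g(σ³ρ_r) ((w−v)·n̂)₊]` of the TRUE dynamics is, in local-Gibbs probability,
the sum over `k` of the crux's diagonal Enskog terms `σ³∫∫χ g Y B(Ξ_P^{kk})`. -/
def EnskogFrequencyLawSplit : Prop :=
  ∃ η₀ : ℝ, 0 < η₀ ∧ ∀ (a₀ θ₀ : T3 → ℝ) (u₀ : T3 → V3), Continuous a₀ → Continuous θ₀ →
    Continuous u₀ → (∀ x, 0 < a₀ x) → (∀ x, 0 < θ₀ x) → ∃ σ₀ : ℝ, 0 < σ₀ ∧ ∀ σ : ℝ, 0 < σ →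
    σ < σ₀ → ∀ Φ : (N : ℕ) → HardSphereFlow G3 (hsDiameter σ N) (N + 1), ∀ τ : ℝ, 0 < τ →
    ∀ χ : ℝ × T3 → ℝ, Continuous χ → ∀ g : ℝ → ℝ, Continuous g → (∀ a, η₀ ≤ a → g a = 0) →
    ∀ η δ : ℝ, 0 < η → 0 < δ → ∃ r₀ : ℝ, 0 < r₀ ∧ ∀ r : ℝ, 0 < r → r < r₀ → ∃ N₀ : ℕ,
    ∀ N : ℕ, N₀ ≤ N →
      let ε := hsDiameter σ N
      let γ := fun z (s : ℝ) => (Φ N).flow s z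
      let KΞ := fun (Ξ : E3 × E3 × E3 → ℝ) z =>
        Kc ε τ γ (fun z s i j => χ (s, (γ z s i).1) * g (σ ^ 3 * rhoM r (γ z s) (γ z s i).1) *
          Ξ (ε⁻¹ • G3.sepVec (γ z s i).1 (γ z s j).1, (pv (γ z s) i j).1, (pv (γ z s) i j).2)) z
      let IΞ := fun (Ξ : E3 × E3 × E3 → ℝ) z =>
        σ ^ 3 * ∫ s in Set.Icc (0 : ℝ) τ, ∫ x : T3,
          χ (s, x) * g (σ ^ 3 * rhoM r (γ z s) x) * Y (σ ^ 3 * rhoM r (γ z s) x) *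
            Bfun r Ξ (γ z s) x
      localGibbsLaw σ a₀ u₀ θ₀ N (Φ N) {z | η < |KΞ XiRate z - ∑ k, IΞ (XiP k k) z|}
        ≤ ENNReal.ofReal δ

/-- **Reduction (proved): `EvenStressEnskog → EnskogFrequencyLawSplit`.** -/
theorem enskogFrequencyLawSplit_of_evenStressEnskog (h : EvenStressEnskog) :
    EnskogFrequencyLawSplit := by
  rw [evenStressEnskog_iff] at h
  obtain ⟨η₀, hη₀, h⟩ := h
  refine ⟨η₀, hη₀, fun a₀ θ₀ u₀ ha hθ hu ha0 hθ0 => ?_⟩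
  obtain ⟨σ₀, hσ₀, h⟩ := h a₀ θ₀ u₀ ha hθ hu ha0 hθ0
  refine ⟨σ₀, hσ₀, fun σ hσ hσlt Φ τ hτ χ hχ g hg hg0 η δ hη hδ => ?_⟩
  obtain ⟨r₀, hr₀, h⟩ :=
    h σ hσ hσlt Φ τ hτ χ hχ g hg hg0 (η / 3) (δ / 3) (by positivity) (by positivity)
  refine ⟨r₀, hr₀, fun r hr hrlt => ?_⟩
  obtain ⟨N₀, h⟩ := h r hr hrlt
  refine ⟨N₀, fun N hN => ?_⟩
  have hk := h N hN
  intro ε γ KΞ IΞ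
  refine measure_rate_le _ (Φ N).good (localGibbsLaw_compl_good (Φ N))
    (fun k z => KΞ (XiP k k) z) (fun k z => IΞ (XiP k k) z) (fun z => KΞ XiRate z) ?_ ?_
  · intro z hz
    have hfin : (collisionTimes G3 ε (γ z) ∩ Set.Icc 0 τ).Finite :=
      ((Φ N).isTrajectory z hz).locFinite 0 τ
    have hadd := Kc_sum ε τ γ (fun k z s i j => χ (s, (γ z s i).1) *
        g (σ ^ 3 * rhoM r (γ z s) (γ z s i).1) *
        XiP k k (ε⁻¹ • G3.sepVec (γ z s i).1 (γ z s j).1, (pv (γ z s) i j).1, (pv (γ z s) i j).2))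
      z hfin
    refine Eq.trans ?_ hadd
    show Kc ε τ γ _ z = Kc ε τ γ _ z
    congr 1
    funext z s i j
    rw [xiRate_eq_sum, Finset.mul_sum]
  · intro k
    exact hk k k

/-- **Kill target 4(a), formal:** a collision-frequency anomaly refutes the crux. -/
theorem not_evenStressEnskog_of_frequency_anomaly (h : ¬ EnskogFrequencyLawSplit) :
    ¬ EvenStressEnskog :=
  mt enskogFrequencyLawSplit_of_evenStressEnskog h


/-! ## §9 (cycle 2) The SWAPPED limit order is junk-TRUE: `r → 0` before `N → ∞`

The crux takes `N → ∞` at fixed `r`, then `r → 0` (`∃ r₀ ∀ r < r₀ ∃ N₀ ∀ N ≥ N₀`). §4 showed that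
the Enskog side dies when `2r < ε_N`. Here is the complementary observation, and the resulting
THEOREM: with the two limits swapped (`∃ N₀ ∀ N ≥ N₀ ∃ r₀ ∀ r < r₀`, i.e. `r₀` may depend on
`N`) the statement is PROVABLE for junk reasons — BOTH sides vanish identically on good orbits.
Mechanism ("self-smearing"): the cutoff in `K_N` is read at the colliding particle,
`g(σ³ρ_r(x_i))`, and `ρ_r(x_i)` contains the particle's OWN cone mass `3/(πr³(N+1))`, which
exceeds any threshold `η₀/σ³` as `r → 0` at fixed `N`; so `g = 0` at every particle and
`K_N[χ g Ξ] = 0` for every mark, while `B_r ≡ 0` once `2r < ε_N`. Moral for planners/provers: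
`r` must never be allowed to depend on `N` (not even `r_N = ε_N/2`), and in the honest order the
self-term `3σ³/(πr³(N+1)) → 0` must be (and can be) absorbed before `r → 0`.
-/

/-- **Self-smearing floor**: the mollified density read AT particle `i` contains that particle's
own cone mass, `3/(πr³(N+1)) ≤ ρ_r(x_i)`. -/
theorem self_le_rhoM {N : ℕ} {r : ℝ} (hr : 0 < r) (z : Config (N + 1) (Fin 3) T3)
    (i : Fin (N + 1)) : 3 / (Real.pi * r ^ 3) / (N + 1 : ℝ) ≤ rhoM r z (z i).1 := by
  unfold rhoM
  rw [integral_empiricalMeasure]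
  have hself : bx r (z i).1 (z i).1 = 3 / (Real.pi * r ^ 3) := by
    simp [bx, Torus.euclidDist_self]
  have hsum : bx r (z i).1 (z i).1 ≤ ∑ k, bx r (z k).1 (z i).1 :=
    Finset.single_le_sum (fun k _ => bx_nonneg hr (z k).1 (z i).1) (Finset.mem_univ i)
  rw [hself] at hsum
  have hN : (0 : ℝ) < ((N + 1 : ℕ) : ℝ) := by positivity
  calc 3 / (Real.pi * r ^ 3) / (N + 1 : ℝ) = ((N + 1 : ℕ) : ℝ)⁻¹ * (3 / (Real.pi * r ^ 3)) := by
        push_cast; ring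
    _ ≤ ((N + 1 : ℕ) : ℝ)⁻¹ * ∑ k, bx r (z k).1 (z i).1 :=
        mul_le_mul_of_nonneg_left hsum (inv_nonneg.mpr hN.le)

/-- **Cutoff saturation by self-smearing**: if `r ≤ 1` and `r ≤ 3σ³/(π(N+1)η₀)` then
`η₀ ≤ σ³ρ_r(x_i)`, so the cutoff kills the weight of EVERY particle: `g(σ³ρ_r(x_i)) = 0`. -/
theorem g_rhoM_self_eq_zero {N : ℕ} {r σ η₀ : ℝ} (hr : 0 < r) (hr1 : r ≤ 1)
    (hrN : r ≤ 3 * σ ^ 3 / (Real.pi * (N + 1 : ℝ) * η₀)) (hσ : 0 < σ) (hη₀ : 0 < η₀)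
    (g : ℝ → ℝ) (hg0 : ∀ a, η₀ ≤ a → g a = 0) (z : Config (N + 1) (Fin 3) T3) (i : Fin (N + 1)) :
    g (σ ^ 3 * rhoM r z (z i).1) = 0 := by
  apply hg0
  have h1 := self_le_rhoM hr z i
  have hN : (0 : ℝ) < (N + 1 : ℝ) := by positivity
  have hpos : 0 < Real.pi * (N + 1 : ℝ) * η₀ := by positivity
  have hA : r * (Real.pi * (N + 1 : ℝ) * η₀) ≤ 3 * σ ^ 3 := (le_div_iff₀ hpos).mp hrN
  have hr3 : r ^ 3 ≤ r := by
    have e : r ^ 3 = r * (r * r) := by ring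
    rw [e]
    refine mul_le_of_le_one_right hr.le ?_
    nlinarith
  have key : η₀ ≤ σ ^ 3 * (3 / (Real.pi * r ^ 3) / (N + 1 : ℝ)) := by
    have e : σ ^ 3 * (3 / (Real.pi * r ^ 3) / (N + 1 : ℝ)) =
        3 * σ ^ 3 / (Real.pi * r ^ 3 * (N + 1 : ℝ)) := by
      field_simp
    rw [e, le_div_iff₀ (by positivity)]
    calc η₀ * (Real.pi * r ^ 3 * (N + 1 : ℝ)) ≤ η₀ * (Real.pi * r * (N + 1 : ℝ)) := by
          apply mul_le_mul_of_nonneg_left _ hη₀.le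
          apply mul_le_mul_of_nonneg_right _ hN.le
          exact mul_le_mul_of_nonneg_left hr3 Real.pi_pos.le
      _ = r * (Real.pi * (N + 1 : ℝ) * η₀) := by ring
      _ ≤ 3 * σ ^ 3 := hA
  exact key.trans (mul_le_mul_of_nonneg_left h1 (pow_pos hσ 3).le)

/-- A `K_N` all of whose weights vanish is `0` — for EVERY configuration and path family (a
`finsum` of zeros is `0`; no finiteness of the collision set is needed). -/
theorem Kc_eq_zero_of_forall {N : ℕ} (ε τ : ℝ)
    (γ : Config (N + 1) (Fin 3) T3 → ℝ → Config (N + 1) (Fin 3) T3)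
    (Fn : Config (N + 1) (Fin 3) T3 → ℝ → Fin (N + 1) → Fin (N + 1) → ℝ)
    (z : Config (N + 1) (Fin 3) T3) (h : ∀ s i j, Fn z s i j = 0) : Kc ε τ γ Fn z = 0 := by
  unfold Kc
  have hs : ∀ s : ℝ, (∑ i : Fin (N + 1), ∑ j : Fin (N + 1),
      (if i ≠ j ∧ ‖G3.sepVec (γ z s i).1 (γ z s j).1‖ = ε then Fn z s i j else 0)) = 0 := by
    intro s
    refine Finset.sum_eq_zero fun i _ => Finset.sum_eq_zero fun j _ => ?_
    rw [h s i j]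
    split_ifs <;> rfl
  simp_rw [hs]
  simp

/-- **Both sides of the crux vanish identically in the swapped order.** For fixed `N`, once
`r ≤ 1`, `2r < ε_N` and `r ≤ 3σ³/(π(N+1)η₀)`: on every good orbit the cutoff kills every summand
of `K_N` (`g_rhoM_self_eq_zero`, at every time, for every mark `Ξ`, weight `χ`, horizon `τ`) and
`B_r ≡ 0` (`Bfun_flow_eq_zero_of_two_r_lt`), so the random variable `Dm Ξ` of the crux is `0`. -/
theorem Dm_eq_zero_swapped {N : ℕ} {σ η₀ r : ℝ} (hσ : 0 < σ) (hη₀ : 0 < η₀) (hr : 0 < r)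
    (hr1 : r ≤ 1) (hrε : 2 * r < hsDiameter σ N)
    (hrN : r ≤ 3 * σ ^ 3 / (Real.pi * (N + 1 : ℝ) * η₀))
    (Φ : HardSphereFlow G3 (hsDiameter σ N) (N + 1)) (τ : ℝ) (χ : ℝ × T3 → ℝ) (g : ℝ → ℝ)
    (hg0 : ∀ a, η₀ ≤ a → g a = 0) (Ξ : E3 × E3 × E3 → ℝ) {z : Config (N + 1) (Fin 3) T3}
    (hz : z ∈ Φ.good) :
    Kc (hsDiameter σ N) τ (fun z s => Φ.flow s z)
        (fun z s i j => χ (s, (Φ.flow s z i).1) *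
          g (σ ^ 3 * rhoM r (Φ.flow s z) (Φ.flow s z i).1) *
          Ξ ((hsDiameter σ N)⁻¹ • G3.sepVec (Φ.flow s z i).1 (Φ.flow s z j).1,
            (pv (Φ.flow s z) i j).1, (pv (Φ.flow s z) i j).2)) z -
      σ ^ 3 * ∫ s in Set.Icc (0 : ℝ) τ, ∫ x : T3,
        χ (s, x) * g (σ ^ 3 * rhoM r (Φ.flow s z) x) * Y (σ ^ 3 * rhoM r (Φ.flow s z) x) *
          Bfun r Ξ (Φ.flow s z) x = 0 := by
  have hK : Kc (hsDiameter σ N) τ (fun z s => Φ.flow s z)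
      (fun z s i j => χ (s, (Φ.flow s z i).1) *
        g (σ ^ 3 * rhoM r (Φ.flow s z) (Φ.flow s z i).1) *
        Ξ ((hsDiameter σ N)⁻¹ • G3.sepVec (Φ.flow s z i).1 (Φ.flow s z j).1,
          (pv (Φ.flow s z) i j).1, (pv (Φ.flow s z) i j).2)) z = 0 :=
    Kc_eq_zero_of_forall _ _ _ _ z fun s i j => by
      rw [g_rhoM_self_eq_zero hr hr1 hrN hσ hη₀ g hg0 (Φ.flow s z) i]; ring
  have hB : ∀ s x, Bfun r Ξ (Φ.flow s z) x = 0 := fun s x =>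
    Bfun_flow_eq_zero_of_two_r_lt hr hrε Φ hz s Ξ x
  simp_rw [hB, hK]
  simp

/-- **The crux with the limit order SWAPPED** — `∃ N₀ ∀ N ≥ N₀ ∃ r₀ ∀ r < r₀` (so `r₀` may depend
on `N`: `r → 0` BEFORE `N → ∞`), everything else verbatim the route decl. -/
def EvenStressEnskogSwapped : Prop :=
  ∃ η₀ : ℝ, 0 < η₀ ∧ ∀ (a₀ θ₀ : T3 → ℝ) (u₀ : T3 → V3), Continuous a₀ → Continuous θ₀ →
    Continuous u₀ → (∀ x, 0 < a₀ x) → (∀ x, 0 < θ₀ x) → ∃ σ₀ : ℝ, 0 < σ₀ ∧ ∀ σ : ℝ, 0 < σ →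
    σ < σ₀ → ∀ Φ : (N : ℕ) → HardSphereFlow G3 (hsDiameter σ N) (N + 1), ∀ τ : ℝ, 0 < τ →
    ∀ χ : ℝ × T3 → ℝ, Continuous χ → ∀ g : ℝ → ℝ, Continuous g → (∀ a, η₀ ≤ a → g a = 0) →
    ∀ η δ : ℝ, 0 < η → 0 < δ → ∃ N₀ : ℕ, ∀ N : ℕ, N₀ ≤ N → ∃ r₀ : ℝ, 0 < r₀ ∧ ∀ r : ℝ, 0 < r →
    r < r₀ →
      let ε := hsDiameter σ N
      let γ := fun z (s : ℝ) => (Φ N).flow s z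
      let Dm := fun (Ξ : E3 × E3 × E3 → ℝ) z =>
        Kc ε τ γ (fun z s i j => χ (s, (γ z s i).1) * g (σ ^ 3 * rhoM r (γ z s) (γ z s i).1) *
          Ξ (ε⁻¹ • G3.sepVec (γ z s i).1 (γ z s j).1, (pv (γ z s) i j).1, (pv (γ z s) i j).2)) z -
        σ ^ 3 * ∫ s in Set.Icc (0 : ℝ) τ, ∫ x : T3,
          χ (s, x) * g (σ ^ 3 * rhoM r (γ z s) x) * Y (σ ^ 3 * rhoM r (γ z s) x) *
            Bfun r Ξ (γ z s) x
      ∀ k l : Fin 3, localGibbsLaw σ a₀ u₀ θ₀ N (Φ N) {z | η < |Dm (XiP k l) z|} ≤ ENNReal.ofReal δ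

/-- **THEOREM: the swapped-order crux is (junk-)TRUE**, with `η₀ := 1`, `σ₀ := 1`, `N₀ := 0`,
`r₀(N) := min (min 1 (ε_N/2)) (3σ³/(π(N+1)))` — the deviation event is contained in the
Liouville-null bad set of the flow. So the ORDER of the two limits carries all the content of
`EvenStressEnskog`; a proof that is insensitive to it proves nothing. -/
theorem evenStressEnskogSwapped_holds : EvenStressEnskogSwapped := by
  refine ⟨1, one_pos, fun a₀ θ₀ u₀ _ _ _ _ _ => ⟨1, one_pos, ?_⟩⟩
  intro σ hσ _ Φ τ _ χ _ g _ hg0 η δ hη _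
  refine ⟨0, fun N _ => ?_⟩
  have hεpos : 0 < hsDiameter σ N := hsDiameter_pos hσ N
  have hq : 0 < 3 * σ ^ 3 / (Real.pi * (N + 1 : ℝ) * 1) := by positivity
  refine ⟨min (min 1 (hsDiameter σ N / 2)) (3 * σ ^ 3 / (Real.pi * (N + 1 : ℝ) * 1)),
    lt_min (lt_min one_pos (half_pos hεpos)) hq, fun r hr hrlt => ?_⟩
  intro ε γ Dm k l
  have hr1 : r ≤ 1 := (hrlt.le.trans (min_le_left _ _)).trans (min_le_left _ _)
  have hrε : 2 * r < hsDiameter σ N := by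
    have := (hrlt.trans_le (min_le_left _ _)).trans_le (min_le_right _ _)
    linarith
  have hrN : r ≤ 3 * σ ^ 3 / (Real.pi * (N + 1 : ℝ) * 1) := hrlt.le.trans (min_le_right _ _)
  have hzero : ∀ z ∈ (Φ N).good, Dm (XiP k l) z = 0 := fun z hz =>
    Dm_eq_zero_swapped hσ one_pos hr hr1 hrε hrN (Φ N) τ χ g hg0 (XiP k l) hz
  calc localGibbsLaw σ a₀ u₀ θ₀ N (Φ N) {z | η < |Dm (XiP k l) z|}
      ≤ localGibbsLaw σ a₀ u₀ θ₀ N (Φ N) (Φ N).goodᶜ := by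
        refine measure_mono fun z hz' hzg => ?_
        have h0 := hzero z hzg
        simp only [Set.mem_setOf_eq] at hz'
        rw [h0, abs_zero] at hz'
        exact absurd hz' (not_lt.mpr hη.le)
    _ = 0 := localGibbsLaw_compl_good (Φ N)
    _ ≤ ENNReal.ofReal δ := zero_le

/-- The same junk truth on the diagonal `r_N := ε_N/2 · c` needs only `24/(πc³) ≥ η₀`; in
particular the "natural" choice `r_N = ε_N/2` (when also `ε_N ≤ 2`) kills both sides for every
`η₀ ≤ 24/π`. Recorded as the arithmetic fact behind it: `(N+1)(ε_N/2)³ = σ³/8`. -/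
theorem succ_mul_half_hsDiameter_pow_three (σ : ℝ) (N : ℕ) :
    ((N + 1 : ℕ) : ℝ) * (hsDiameter σ N / 2) ^ 3 = σ ^ 3 / 8 := by
  rw [div_pow, ← mul_div_assoc, succ_mul_hsDiameter_pow_three]
  norm_num

/-! ## §10 (cycle 2) The Enskog side is an honest quadratic form: second-moment blindness

`Θ(Ξ_P^{kl})(v,w) = ∫ ((w−v)·ω)₊² ω_k ω_l dω = ½ ∫ ((w−v)·ω)² ω_k ω_l dω` by the antipodal
symmetry of the sphere measure. Consequences, all proved: `Θ^{kl}` is a quadratic form of the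
relative velocity (Galilei invariant, symmetric in `v ↔ w`, homogeneous of degree `2`), so the
Enskog functional `B_r(Ξ_P^{kl})` reads the local velocity law ONLY through `ρ_r`, the momentum
`m_r` and the second moments — it is blind to the shape of the one-body law (the "(ME) h-blind
target" of card even-rung-mean-variance is thereby a theorem, not a modelling step). For the
adversary this sharpens kill target 4(a)/(b): ONLY the pair CORRELATION at contact can break the
crux, never a non-Maxwellian one-body law with Maxwellian second moments. It also corrects a
loose word of cycle 1: the trace mark `XiRate` measures the IMPULSE sum `Σ_coll 2|g·n̂|`
(`Θ(XiRate) = ½∫((w−v)·ω)²dω ∝ |w−v|²`, the collisional virial / pressure), not the bare collision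
COUNT (mark `1`, `Θ(1) = π|w−v|`, first absolute moment — NOT implied by the crux). §6 item 4(a)
and §8 are to be read with "collision frequency" ↦ "impulse rate (collisional virial)": an
anomalous collision count with the correct impulse sum would NOT refute the crux.
-/

/-- `(a)₊² + (−a)₊² = a²`. -/
theorem max_zero_sq_add_max_neg_zero_sq (a : ℝ) : max a 0 ^ 2 + max (-a) 0 ^ 2 = a ^ 2 := by
  rcases le_total 0 a with h | h
  · rw [max_eq_left h, max_eq_right (by linarith), zero_pow two_ne_zero, add_zero]
  · rw [max_eq_right h, max_eq_left (by linarith)]; ring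

/-- `Θ(Ξ_P^{kl})(v,w) = ∫ ((w−v)·ω)₊² ω_k ω_l dω`. -/
theorem Theta_XiP_eq (k l : Fin 3) (v w : E3) :
    Theta (XiP k l) v w = ∫ ω : Metric.sphere (0 : E3) 1,
      max ⟪w - v, ((ω : E3))⟫_ℝ 0 ^ 2 * ((ω : E3) k * (ω : E3) l) ∂sphereMeasure := by
  unfold Theta XiP hardSphereKernel
  congr 1
  funext ω
  simp only
  ring

/-- **Half-quadratic identity**: `Θ(Ξ_P^{kl})(v,w) = ½ ∫ ((w−v)·ω)² ω_k ω_l dω`. -/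
theorem Theta_XiP_eq_half (k l : Fin 3) (v w : E3) :
    Theta (XiP k l) v w = 1 / 2 * ∫ ω : Metric.sphere (0 : E3) 1,
      ⟪w - v, ((ω : E3))⟫_ℝ ^ 2 * ((ω : E3) k * (ω : E3) l) ∂sphereMeasure := by
  rw [Theta_XiP_eq]
  set F : Metric.sphere (0 : E3) 1 → ℝ :=
    fun ω => max ⟪w - v, ((ω : E3))⟫_ℝ 0 ^ 2 * ((ω : E3) k * (ω : E3) l) with hFdef
  haveI := Literature.Analysis.FluidPDE.isFiniteMeasure_sphereMeasure (E := E3)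
  have hFc : Continuous F := by
    rw [hFdef]
    fun_prop
  have hFi : Integrable F sphereMeasure :=
    hFc.integrable_of_hasCompactSupport (isClosed_tsupport _).isCompact
  have hFn : ∀ ω : Metric.sphere (0 : E3) 1,
      F (-ω) = max (-⟪w - v, ((ω : E3))⟫_ℝ) 0 ^ 2 * ((ω : E3) k * (ω : E3) l) := by
    intro ω
    simp only [hFdef, coe_neg_sphere, inner_neg_right, PiLp.neg_apply, neg_mul_neg]
  have hFni : Integrable (fun ω => F (-ω)) sphereMeasure :=
    (hFc.comp continuous_neg).integrable_of_hasCompactSupport (isClosed_tsupport _).isCompact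
  have hsum : ∀ ω : Metric.sphere (0 : E3) 1,
      F ω + F (-ω) = ⟪w - v, ((ω : E3))⟫_ℝ ^ 2 * ((ω : E3) k * (ω : E3) l) := by
    intro ω
    rw [hFn]
    simp only [hFdef]
    rw [← add_mul, max_zero_sq_add_max_neg_zero_sq]
  have hneg : ∫ ω, F (-ω) ∂sphereMeasure = ∫ ω, F ω ∂sphereMeasure :=
    Literature.Analysis.FluidPDE.integral_comp_neg_sphere F
  have h2 : ∫ ω, F ω ∂sphereMeasure + ∫ ω, F (-ω) ∂sphereMeasure =
      ∫ ω : Metric.sphere (0 : E3) 1, ⟪w - v, ((ω : E3))⟫_ℝ ^ 2 * ((ω : E3) k * (ω : E3) l)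
        ∂sphereMeasure := by
    rw [← integral_add hFi hFni]
    exact integral_congr_ae (Filter.Eventually.of_forall hsum)
  show ∫ ω, F ω ∂sphereMeasure = _
  rw [← h2, hneg]
  ring

/-- `Θ^{kl}` depends on the RELATIVE velocity only (Galilei invariance of the Enskog side). -/
theorem Theta_XiP_galilei (k l : Fin 3) (v w u : E3) :
    Theta (XiP k l) (v + u) (w + u) = Theta (XiP k l) v w := by
  rw [Theta_XiP_eq, Theta_XiP_eq, add_sub_add_right_eq_sub]

/-- `Θ^{kl}` is symmetric under `v ↔ w` (the two ordered pairs of one collision agree on the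
Enskog side too, cf. `xiP_swap`). -/
theorem Theta_XiP_symm (k l : Fin 3) (v w : E3) :
    Theta (XiP k l) w v = Theta (XiP k l) v w := by
  rw [Theta_XiP_eq_half, Theta_XiP_eq_half]
  congr 1
  refine integral_congr_ae (Filter.Eventually.of_forall fun ω => ?_)
  simp only
  rw [← neg_sub w v, inner_neg_left, neg_sq]

/-- `Θ^{kl}` is homogeneous of degree two (kinematic scale covariance `v ↦ cv` of the Enskog
side; the hard-sphere flow itself is covariant under `v ↦ cv, t ↦ t/c`). -/
theorem Theta_XiP_smul (k l : Fin 3) (c : ℝ) (v w : E3) :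
    Theta (XiP k l) (c • v) (c • w) = c ^ 2 * Theta (XiP k l) v w := by
  rw [Theta_XiP_eq_half, Theta_XiP_eq_half, ← smul_sub c w v]
  rw [show c ^ 2 * (1 / 2 * ∫ ω : Metric.sphere (0 : E3) 1,
        ⟪w - v, ((ω : E3))⟫_ℝ ^ 2 * ((ω : E3) k * (ω : E3) l) ∂sphereMeasure)
      = 1 / 2 * ∫ ω : Metric.sphere (0 : E3) 1,
        c ^ 2 * (⟪w - v, ((ω : E3))⟫_ℝ ^ 2 * ((ω : E3) k * (ω : E3) l)) ∂sphereMeasure by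
    rw [integral_const_mul]; ring]
  congr 1
  refine integral_congr_ae (Filter.Eventually.of_forall fun ω => ?_)
  simp only
  rw [real_inner_smul_left]
  ring

/-- `Θ^{kl}` is symmetric in `(k,l)` and so is everything downstream (`B_r`, the crux's nine
statements reduce to six). -/
theorem Theta_XiP_comm (k l : Fin 3) (v w : E3) : Theta (XiP k l) v w = Theta (XiP l k) v w := by
  rw [Theta_XiP_eq, Theta_XiP_eq]
  congr 1; funext ω; ring

/-- Singletons of the pair phase space are measurable (instance supplied by hand: automatic
synthesis does not find `Prod.instMeasurableSingletonClass` on the fourfold product). -/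
instance instMeasurableSingletonClassPair :
    MeasurableSingletonClass ((T3 × E3) × (T3 × E3)) := Prod.instMeasurableSingletonClass

/-- The product of two empirical measures is the normalised sum of the pair Dirac masses. -/
theorem empiricalMeasure_prod_eq {N : ℕ} (z : Config (N + 1) (Fin 3) T3) :
    (empiricalMeasure z).prod (empiricalMeasure z) =
      (((N + 1 : ℕ) : ℝ≥0∞)⁻¹ * ((N + 1 : ℕ) : ℝ≥0∞)⁻¹) •
        Measure.sum (fun p : Fin (N + 1) × Fin (N + 1) => Measure.dirac (z p.1, z p.2)) := by
  rw [empiricalMeasure_eq, ← Measure.sum_fintype, Measure.prod_smul_left, Measure.prod_smul_right,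
    smul_smul, Measure.prod_sum]
  congr 1
  congr 1
  funext p
  exact Measure.dirac_prod_dirac

/-- Integration against the PRODUCT of empirical measures is the normalised double sum:
`∫ F d(μ_z ⊗ μ_z) = (N+1)⁻² Σ_i Σ_j F(z_i, z_j)` (diagonal included). Provers need exactly this to
handle `B_r`; with `Theta_XiP_eq_half` it exhibits `B_r(Ξ_P^{kl})` as a quadratic expression in
the mollified moments `ρ_r, m_r, S_r`. -/
theorem integral_prod_empiricalMeasure {N : ℕ} (z : Config (N + 1) (Fin 3) T3)
    (F : (T3 × E3) × (T3 × E3) → ℝ) :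
    ∫ p, F p ∂((empiricalMeasure z).prod (empiricalMeasure z)) =
      ((N + 1 : ℕ) : ℝ)⁻¹ * ((N + 1 : ℕ) : ℝ)⁻¹ * ∑ i, ∑ j, F (z i, z j) := by
  rw [empiricalMeasure_prod_eq, integral_smul_measure, Measure.sum_fintype,
    integral_finsetSum_measure fun p _ => integrable_dirac (by simp)]
  simp only [integral_dirac, smul_eq_mul, ENNReal.toReal_mul, ENNReal.toReal_inv,
    ENNReal.toReal_natCast, Fintype.sum_prod_type]

/-- `B_r` as the explicit normalised double sum over ordered pairs of particles. -/
theorem Bfun_eq_sum {N : ℕ} (r : ℝ) (Ξ : E3 × E3 × E3 → ℝ) (z : Config (N + 1) (Fin 3) T3)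
    (x₀ : T3) :
    Bfun r Ξ z x₀ = ((N + 1 : ℕ) : ℝ)⁻¹ * ((N + 1 : ℕ) : ℝ)⁻¹ *
      ∑ i, ∑ j, bx r (z i).1 x₀ * bx r (z j).1 x₀ * Theta Ξ (z i).2 (z j).2 := by
  unfold Bfun
  rw [integral_prod_empiricalMeasure]


/-! ## §11 (cycle 2) Moment form of the Enskog functional

With §10, `B_r(Ξ_P^{kl})(x₀) = (N+1)⁻² ∫_{S²} [S₀·S₂(ω) − S₁(ω)²] ω_k ω_l dω`, where
`S₀ = Σ_i b_r(x_i,x₀)` (∝ mollified density), `S₁(ω) = Σ_i b_r(x_i,x₀)⟪v_i,ω⟫` (directional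
momentum) and `S₂(ω) = Σ_i b_r(x_i,x₀)⟪v_i,ω⟫²` (directional kinetic energy): the Enskog side of the
crux is an explicit functional of the local ZEROTH, FIRST and SECOND velocity moments only
(by Cauchy–Schwarz `S₀S₂ − S₁² ≥ 0`: it is a local velocity VARIANCE in direction `ω`). At a local
Maxwellian state `(ρ,u,θ)` and `r → 0` this is `ρ²θ ∫ ω_kω_l dω = (4π/3)ρ²θ δ_kl`, i.e. the crux's
prediction is the isotropic collisional pressure `σ³ Y(σ³ρ) (4π/3) ρ²θ` per unit `χ`-weight and
ZERO collisional shear stress — whatever the shape of the one-body law beyond its covariance.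
-/

/-- The weighted double-sum identity behind the moment form:
`Σ_i Σ_j b_i b_j (p_j − p_i)² = 2 (S₀ Σ_i b_i p_i² − (Σ_i b_i p_i)²)`. -/
theorem sum_sum_mul_mul_sq_sub {n : ℕ} (b p : Fin n → ℝ) :
    ∑ i, ∑ j, b i * b j * (p j - p i) ^ 2 =
      2 * ((∑ i, b i) * (∑ i, b i * p i ^ 2) - (∑ i, b i * p i) ^ 2) := by
  have hA : ∑ i, ∑ j, b i * (b j * p j ^ 2) = (∑ i, b i) * (∑ j, b j * p j ^ 2) := by
    rw [Finset.sum_mul_sum]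
  have hA' : ∑ i, ∑ j, b i * p i ^ 2 * b j = (∑ i, b i) * (∑ j, b j * p j ^ 2) := by
    rw [Finset.sum_comm, Finset.sum_mul_sum]
    exact Finset.sum_congr rfl fun i _ => Finset.sum_congr rfl fun j _ => by ring
  have hC : ∑ i, ∑ j, b i * p i * (b j * p j) = (∑ i, b i * p i) ^ 2 := by
    rw [sq, Finset.sum_mul_sum]
  calc ∑ i, ∑ j, b i * b j * (p j - p i) ^ 2
      = ∑ i, ∑ j, (b i * (b j * p j ^ 2) + b i * p i ^ 2 * b j - 2 * (b i * p i * (b j * p j))) :=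
        Finset.sum_congr rfl fun i _ => Finset.sum_congr rfl fun j _ => by ring
    _ = ∑ i, ∑ j, b i * (b j * p j ^ 2) + ∑ i, ∑ j, b i * p i ^ 2 * b j
          - 2 * ∑ i, ∑ j, b i * p i * (b j * p j) := by
        simp only [Finset.sum_add_distrib, Finset.sum_sub_distrib, Finset.mul_sum]
    _ = _ := by rw [hA, hA', hC]; ring

/-- **Moment form of the Enskog pair functional for the momentum-transfer marks.** -/
theorem Bfun_XiP_eq_moment {N : ℕ} (k l : Fin 3) (r : ℝ) (z : Config (N + 1) (Fin 3) T3)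
    (x₀ : T3) :
    Bfun r (XiP k l) z x₀ = ((N + 1 : ℕ) : ℝ)⁻¹ * ((N + 1 : ℕ) : ℝ)⁻¹ *
      ∫ ω : Metric.sphere (0 : E3) 1,
        ((∑ i, bx r (z i).1 x₀) * (∑ i, bx r (z i).1 x₀ * ⟪(z i).2, ((ω : E3))⟫_ℝ ^ 2) -
          (∑ i, bx r (z i).1 x₀ * ⟪(z i).2, ((ω : E3))⟫_ℝ) ^ 2) * ((ω : E3) k * (ω : E3) l)
        ∂sphereMeasure := by
  rw [Bfun_eq_sum]
  congr 1
  haveI := Literature.Analysis.FluidPDE.isFiniteMeasure_sphereMeasure (E := E3)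
  -- each pair term as one sphere integral
  set G : Fin (N + 1) → Fin (N + 1) → Metric.sphere (0 : E3) 1 → ℝ := fun i j ω =>
    bx r (z i).1 x₀ * bx r (z j).1 x₀ / 2 *
      (⟪(z j).2 - (z i).2, ((ω : E3))⟫_ℝ ^ 2 * ((ω : E3) k * (ω : E3) l)) with hG
  have hGi : ∀ i j, Integrable (G i j) sphereMeasure := by
    intro i j
    have hc : Continuous (G i j) := by rw [hG]; fun_prop
    exact hc.integrable_of_hasCompactSupport (isClosed_tsupport _).isCompact
  have h1 : ∀ i j, bx r (z i).1 x₀ * bx r (z j).1 x₀ * Theta (XiP k l) (z i).2 (z j).2 =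
      ∫ ω, G i j ω ∂sphereMeasure := by
    intro i j
    rw [Theta_XiP_eq_half, ← mul_assoc, ← integral_const_mul]
    congr 1
    funext ω
    simp only [hG]
    ring
  simp_rw [h1]
  have h2 : ∀ i, ∑ j, ∫ ω, G i j ω ∂sphereMeasure = ∫ ω, ∑ j, G i j ω ∂sphereMeasure := fun i =>
    (integral_finsetSum _ (fun j _ => hGi i j)).symm
  simp_rw [h2]
  rw [← integral_finsetSum _ (fun i _ => integrable_finsetSum _ (fun j _ => hGi i j))]
  congr 1
  funext ω
  have h3 : ∀ i j, G i j ω = (ω : E3) k * (ω : E3) l / 2 *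
      (bx r (z i).1 x₀ * bx r (z j).1 x₀ * (⟪(z j).2, ((ω : E3))⟫_ℝ - ⟪(z i).2, ((ω : E3))⟫_ℝ) ^ 2) := by
    intro i j
    simp only [hG, inner_sub_left]
    ring
  simp_rw [h3, ← Finset.mul_sum]
  have h4 := sum_sum_mul_mul_sq_sub (fun i => bx r (z i).1 x₀) (fun i => ⟪(z i).2, ((ω : E3))⟫_ℝ)
  rw [h4]
  ring


/-! ## §12 (cycle 2) Hidden content of the crux: MESOSCALE COMPACTNESS (the two-stream texture)

A consequence of §10–§11 that sharpens §6.3 ("TRUE iff local equilibrium propagates in the two-body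
contact channel") — that characterisation was INCOMPLETE. The Enskog side reads the velocity
VARIANCE of the `r`-ball empirical law (`S₀S₂ − S₁²`, §11), i.e. the thermal spread PLUS any
coherent velocity texture at scales below `r`; the collision side `K_N` only sees relative
velocities of pairs AT CONTACT (scale `ε_N`). Consider a "two-stream texture": inside an
`r`-ball the particles form two families with velocities `u₁ ≠ u₂` (layers / filaments of
thickness `ℓ` with `ε_N ≪ ℓ ≪ r`, each family spatially segregated from the other by more than
`ε_N`). Then (`Bfun_two_stream`) `B_r(Ξ_P^{kl}) = 2c² W₁W₂ Θ^{kl}(u₁,u₂)` with trace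
`2c²W₁W₂ · ½∫((u₂−u₁)·ω)² dω > 0` (`Theta_trace_pos`), while NO pair of one family has a nonzero
relative velocity and the two families never touch: along free flight `K_N ≡ 0`. So the crux
FAILS SURELY on such textured configurations, by an `O(σ³ Y |u₁−u₂|²)` amount that does NOT
decrease as `r → 0` if the texture scale `ℓ = ℓ_N → 0`. With a thermal spread added inside each
family the families are each in local equilibrium — KINETIC local equilibrium (crux #2's
Maxwellian contact law, the two-body contact value `Y`) can hold exactly while the crux fails:
what fails is that the `N → ∞` limit of the empirical velocity field is then a non-Dirac YOUNG
MEASURE at scale `r` (weak but not strong compactness; an "oscillation / energy defect" between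
the mean free path `λ_N ≍ N^{-1/3}` and every macroscopic `r`).

Hence **`EvenStressEnskog` ⇒ (essentially) strong compactness of the empirical velocity field at
mesoscales, a.e. on `[0,τ] × 𝕋³`** — hidden content beyond two-body local equilibrium, carried
in the line `even-rung-mean-variance` by S3 `stub_meanEnskog` (its docstring's "strong
precompactness at scale `r`" input) and invisible to S1/S2/S4/S5/S6. STATUS of this threat:
(i) from smooth local-Gibbs profiles, thermal-noise-seeded shear instabilities need times
`≍ log N → ∞` to reach `O(1)` amplitude at fixed `τ`, so PRE-SHOCK (`τ < T`) no texture forms and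
the route's own mv–strong uniqueness (ParityInBand) is consistent with the crux; (ii) POST-
SINGULARITY (`τ ≥ T*`: shocks, slip surfaces from shock interactions, Kelvin–Helmholtz roll-up,
implosions) the physical continuation is not known to be oscillation-free; isolated slip
surfaces are harmless (measure `O(r) → 0`), and Kolmogorov phenomenology (sub-`r` energy
`≲ r^{2/3}` uniformly in the viscosity `≍ λ_N`) predicts NO defect — so the crux stays
physically plausible `∀ τ`, but any PROOF for `τ` beyond blow-up would have to establish a
K41-type "no energy pile-up between `λ_N` and `o(1)` scales" statement for deterministic hard
spheres. RECOMMENDATION (planner / lead; strengthens the triagers' route-level remark R with a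
mechanism): restrict the crux to `τ < T` (classical Euler time), or name the compactness
antecedent explicitly; a refuter looking for `¬EvenStressEnskog` should look for persistent
mesoscale shear texture after singularity formation, NOT for a non-equilibrium contact value.
-/

/-- Trace of the sphere-integrated momentum-transfer marks: `Σ_k Θ(Ξ_P^{kk})(v,w) = ∫((w−v)·ω)₊² dω`. -/
theorem Theta_trace_eq (v w : E3) :
    ∑ k, Theta (XiP k k) v w =
      ∫ ω : Metric.sphere (0 : E3) 1, max ⟪w - v, ((ω : E3))⟫_ℝ 0 ^ 2 ∂sphereMeasure := by
  haveI := Literature.Analysis.FluidPDE.isFiniteMeasure_sphereMeasure (E := E3)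
  unfold Theta
  rw [← integral_finsetSum _ (fun k _ => ?_)]
  · congr 1
    funext ω
    rw [← Finset.sum_mul, xiP_trace (ω : E3) v w, hardSphereKernel]
    simp only [norm_eq_of_mem_sphere ω]
    ring
  · have hc : Continuous fun ω : Metric.sphere (0 : E3) 1 =>
        XiP k k (((ω : E3)), v, w) * hardSphereKernel (w, v) ω := by
      unfold XiP hardSphereKernel
      fun_prop
    exact hc.integrable_of_hasCompactSupport (isClosed_tsupport _).isCompact

/-- Elementary: if `f` and `f²` are integrable for a finite measure and `∫ f > 0` then `∫ f² > 0`
(from `(f − c)² ≥ 0` with `c = ∫f / μ(univ)`). -/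
theorem integral_sq_pos_of_integral_pos {α : Type*} [MeasurableSpace α] {μ : Measure α}
    [IsFiniteMeasure μ] {f : α → ℝ} (hf : Integrable f μ) (hf2 : Integrable (fun a => f a ^ 2) μ)
    (hpos : 0 < ∫ a, f a ∂μ) : 0 < ∫ a, f a ^ 2 ∂μ := by
  set m : ℝ := μ.real Set.univ with hm
  set I : ℝ := ∫ a, f a ∂μ with hI
  have key : ∀ c : ℝ, 2 * c * I - c ^ 2 * m ≤ ∫ a, f a ^ 2 ∂μ := by
    intro c
    have h1 : ∫ a, (2 * c * f a - c ^ 2) ∂μ ≤ ∫ a, f a ^ 2 ∂μ := by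
      refine integral_mono ((hf.const_mul (2 * c)).sub (integrable_const _)) hf2 fun a => ?_
      nlinarith [sq_nonneg (f a - c)]
    have h2 : ∫ a, (2 * c * f a - c ^ 2) ∂μ = 2 * c * I - c ^ 2 * m := by
      rw [integral_sub (hf.const_mul _) (integrable_const _), integral_const_mul, integral_const,
        smul_eq_mul, hm, hI]
      ring
    linarith
  by_cases h0 : m = 0
  · have := key 1
    rw [h0, mul_zero, sub_zero] at this
    linarith
  · have hmpos : 0 < m := lt_of_le_of_ne measureReal_nonneg (Ne.symm h0)
    have := key (I / m)
    have e : 2 * (I / m) * I - (I / m) ^ 2 * m = I ^ 2 / m := by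
      field_simp
      ring
    rw [e] at this
    exact lt_of_lt_of_le (by positivity) this

/-- **The Enskog side is strictly positive on every pair of distinct velocities**:
`0 < Σ_k Θ(Ξ_P^{kk})(v,w)` for `v ≠ w` (via the Lorentz loss frequency `∫((w−v)·ω)₊dω =
‖w−v‖·ν(e) > 0` and `∫f² ≥ (∫f)²/|S²|`). -/
theorem Theta_trace_pos {v w : E3} (h : v ≠ w) : 0 < ∑ k, Theta (XiP k k) v w := by
  rw [Theta_trace_eq]
  haveI := Literature.Analysis.FluidPDE.isFiniteMeasure_sphereMeasure (E := E3)
  have hc : Continuous fun ω : Metric.sphere (0 : E3) 1 => max ⟪w - v, ((ω : E3))⟫_ℝ 0 := by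
    fun_prop
  have hf : Integrable (fun ω : Metric.sphere (0 : E3) 1 => max ⟪w - v, ((ω : E3))⟫_ℝ 0)
      sphereMeasure := hc.integrable_of_hasCompactSupport (isClosed_tsupport _).isCompact
  have hf2 : Integrable (fun ω : Metric.sphere (0 : E3) 1 => max ⟪w - v, ((ω : E3))⟫_ℝ 0 ^ 2)
      sphereMeasure := (hc.pow 2).integrable_of_hasCompactSupport (isClosed_tsupport _).isCompact
  refine integral_sq_pos_of_integral_pos hf hf2 ?_
  have hne : w - v ≠ 0 := sub_ne_zero.mpr (Ne.symm h)
  have hnorm : 0 < ‖w - v‖ := norm_pos_iff.mpr hne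
  set e : E3 := ‖w - v‖⁻¹ • (w - v) with he
  have heu : ‖e‖ = 1 := by
    rw [he, norm_smul, norm_inv, norm_norm, inv_mul_cancel₀ hnorm.ne']
  show 0 < lorentzLossRate (w - v)
  rw [lorentzLossRate_eq_norm_mul heu (w - v)]
  exact mul_pos hnorm (lorentzLossRate_pos (by simp) heu)

/-- **Two-stream evaluation of the Enskog functional.** If every particle has velocity `u₁` or
`u₂`, then `B_r(Ξ_P^{kl})(x₀) = 2 (N+1)⁻² W₁ W₂ Θ^{kl}(u₁,u₂)` with `W₁ = Σ_{v_i = u₁} b_r(x_i,x₀)`,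
`W₂ = Σ_{v_i ≠ u₁} b_r(x_i,x₀)`: only CROSS pairs contribute (`Θ(u,u) = 0`), symmetrically
(`Theta_XiP_symm`). On a textured configuration whose two families are spatially segregated by
more than `ε`, no cross pair ever collides and no intra-family pair has a relative velocity: the
collision side of the crux is `0` along free flight while the Enskog side is this positive
quantity (`Theta_trace_pos`) — the sure counterexample pattern behind §12. -/
theorem Bfun_two_stream {N : ℕ} (k l : Fin 3) (r : ℝ) (z : Config (N + 1) (Fin 3) T3) (x₀ : T3)
    (u₁ u₂ : E3) (hv : ∀ i, (z i).2 = u₁ ∨ (z i).2 = u₂) :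
    Bfun r (XiP k l) z x₀ = ((N + 1 : ℕ) : ℝ)⁻¹ * ((N + 1 : ℕ) : ℝ)⁻¹ *
      (2 * ((∑ i ∈ Finset.univ.filter (fun i => (z i).2 = u₁), bx r (z i).1 x₀) *
        (∑ i ∈ Finset.univ.filter (fun i => ¬ (z i).2 = u₁), bx r (z i).1 x₀) *
        Theta (XiP k l) u₁ u₂)) := by
  rw [Bfun_eq_sum]
  congr 1
  classical
  set A := Finset.univ.filter (fun i : Fin (N + 1) => (z i).2 = u₁) with hA
  set B := Finset.univ.filter (fun i : Fin (N + 1) => ¬ (z i).2 = u₁) with hB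
  have hu2 : ∀ i ∈ B, (z i).2 = u₂ := by
    intro i hi
    rw [hB, Finset.mem_filter] at hi
    rcases hv i with h | h
    · exact absurd h hi.2
    · exact h
  have hu1 : ∀ i ∈ A, (z i).2 = u₁ := fun i hi => by
    rw [hA, Finset.mem_filter] at hi; exact hi.2
  have hsplit : ∀ (f : Fin (N + 1) → ℝ), ∑ i, f i = ∑ i ∈ A, f i + ∑ i ∈ B, f i := by
    intro f
    rw [hA, hB, ← Finset.sum_filter_add_sum_filter_not Finset.univ (fun i => (z i).2 = u₁)]
  -- split both sums
  rw [hsplit]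
  simp_rw [hsplit (fun j => bx r (z _).1 x₀ * bx r (z j).1 x₀ * Theta (XiP k l) (z _).2 (z j).2)]
  -- the four blocks
  have hAA : ∑ i ∈ A, ∑ j ∈ A, bx r (z i).1 x₀ * bx r (z j).1 x₀ * Theta (XiP k l) (z i).2 (z j).2 = 0 :=
    Finset.sum_eq_zero fun i hi => Finset.sum_eq_zero fun j hj => by
      rw [hu1 i hi, hu1 j hj, Theta_self, mul_zero]
  have hBB : ∑ i ∈ B, ∑ j ∈ B, bx r (z i).1 x₀ * bx r (z j).1 x₀ * Theta (XiP k l) (z i).2 (z j).2 = 0 :=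
    Finset.sum_eq_zero fun i hi => Finset.sum_eq_zero fun j hj => by
      rw [hu2 i hi, hu2 j hj, Theta_self, mul_zero]
  have hAB : ∑ i ∈ A, ∑ j ∈ B, bx r (z i).1 x₀ * bx r (z j).1 x₀ * Theta (XiP k l) (z i).2 (z j).2 =
      (∑ i ∈ A, bx r (z i).1 x₀) * (∑ j ∈ B, bx r (z j).1 x₀) * Theta (XiP k l) u₁ u₂ := by
    rw [Finset.sum_mul_sum, Finset.sum_mul]
    refine Finset.sum_congr rfl fun i hi => ?_
    rw [Finset.sum_mul]
    refine Finset.sum_congr rfl fun j hj => ?_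
    rw [hu1 i hi, hu2 j hj]
  have hBA : ∑ i ∈ B, ∑ j ∈ A, bx r (z i).1 x₀ * bx r (z j).1 x₀ * Theta (XiP k l) (z i).2 (z j).2 =
      (∑ i ∈ A, bx r (z i).1 x₀) * (∑ j ∈ B, bx r (z j).1 x₀) * Theta (XiP k l) u₁ u₂ := by
    rw [Finset.sum_mul_sum, Finset.sum_mul, Finset.sum_comm]
    refine Finset.sum_congr rfl fun i hi => ?_
    rw [Finset.sum_mul]
    refine Finset.sum_congr rfl fun j hj => ?_
    rw [hu2 j hj, hu1 i hi, Theta_XiP_symm]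
    ring
  simp only [Finset.sum_add_distrib]
  rw [hAA, hBB, hAB, hBA]
  ring

/-! ## Targets (cycle 2, after the lead's PICKED line `even-rung-mean-variance`, lead NOTES 05:40Z)

The lead's STUCK list = S3 `stub_meanEnskog` (general `t > 0`), the tails (H_K)/(H_E) behind S1
`stub_velocityTruncation` for `t > 0`, S2b₁₋₃ behind S2 `stub_cylinderPullback`, S4
`stub_fixedTimeVariance`'s hA/hE for `t > 0`. Examined this cycle against the registered
signatures (Lines/even-rung-mean-variance.lean, reshape v3):

* NO STUB IS REFUTABLE by a small or degenerate model: each is an in-probability / in-mean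
  statement about the evolved local Gibbs law at `t > 0` with the honest quantifier order
  (`r` before `L, κ` before `N`; §9 respected), and each is true at rung 0.
* S3 carries MORE than two-body local equilibrium: by §12 it also asserts mesoscale strong
  compactness of the velocity field (no two-stream texture between `λ_N` and `r`) in the MEAN —
  the docstring's "strong precompactness at scale `r`" caveat is not a technicality but a second
  open input for `∀ τ`; recommendation as in §12 (restrict to `τ < T` or name the antecedent).
  A `stub_meanEnskog_false` would need a local-Gibbs evolution developing persistent positive-
  measure shear texture by time `τ` — not constructible (and physically not expected, K41).
* S1, Enskog half: the tail `B_r(Ξ_P − Ξ_L)` is NOT controlled by the conserved energy — one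
  particle carrying kinetic energy `≍ N` makes `∫_x B_r(Ξ_P − Ξ_L) dx = O(1)` surely (its `≍ N r³`
  neighbours each contribute `|v₁ − v_j|² ≍ N` with weight `(N+1)⁻²(3/(πr³))²`); so (H_E)-type
  uniform integrability must come from the law (relative entropy w.r.t. Gibbs at `t = 0`;
  propagation to `t > 0` is the open part), never from conservation laws. Consistent with the
  lead's own obstruction note ("`μ_s ≤ e^{cN}·G` + Gaussian LDP ⇒ O(1), never o(1)").
* S4/S2b: value-free concentration / counting statements; no cheap attack; no junk found in the
  use of `ProbabilityTheory.variance` (the law is a probability measure for `σ < 1/2`, and the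
  integrand is bounded by S6, so `variance` is the honest one, not the `evariance = ⊤` junk).
-/

end Summit.AtomisticToContinuum.HydrodynamicLimit.Cruxes.EvenStressEnskog.Disproof

end
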